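import Literature.Barriers.CriticalPhenomena.PlaquetteWalkHoleRootSevenAboveFrameTwo
import HarnessLib

/-!
# Barrier catalogue (SAWScalingLimit): the frame of the cost-`7` vertical-end parents above the root row, IV — THE `W`-END PARENTS («COLUMN LAW», W-frame)

`Z → ∞` limit model of the printed Yang–Baxter weights [GlazmanManolescu2019, §1, eq. (1)]; the «RECTANGLE COEFFICIENT» line of the venture lane «pcv-sawmu»
(b-engine-1 g27). The companion of `ΩG.frame_of_cost_seven_E_above` for the parents returning to the `W` side of `r` (census class `(W,4,2,ε,0,−4)`):
★★★ `ΩG.frame_of_cost_seven_W_above`. For these walks the six isolated turns are RIGID: `r`, the east turn `t'` of `r`'s top-row chain, the two bottom turns,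
the root-row turn `τ`, and the top `ξ₀` of the column above the wound excursion's arc on the western ray (`ΩG.exists_arc_west_rootRow_after_fh`) — a top-row
plaquette west of the hole. Hence no plaquette strictly between the bottom row and the top row, off the root row, uses a horizontal side; the walk ends
`b₁ ↑ ξ₀ → L = (r.1 − 1, r.2)`; every doubly visited plaquette lies above the bottom entry turn `b₀`, below `r` or `t'`, and on the root row — so there is at most
one, and it is `p₁` (its `W`-chain would otherwise reach `w` through `p₁`, making `p₁` a second one). Reading the column of `r` then gives: `r.1 = w.1 + k`, the
first turn is `W → N`, the climb into `r` is straight and enters `r` from BELOW (so `r` is left through `E`), and the second arc of `p₁`, if any, is `E → S`.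
[GlazmanManolescu2019 §1 Fig. 1, eq. (1), Lemma 2.1, Remark 2.2; Glazman2015WeightedSAW Lemma 3.1 (proof, pp. 6–7); CourantRobbins1958 Ch. V App. §2]
-/

noncomputable section

namespace Literature.Probability.RandomPlanarGeometry.SAW.YangBaxter

open Real
open Literature.Barriers.CriticalPhenomena.PlaquetteWalk

open private fc_fh fh_add_Mv three_le_Mv from Literature.Probability.RandomPlanarGeometry.YangBaxterSAWGeneralDomain

namespace ΩG

open private sIn_succ_of_sOut_N sIn_succ_of_sOut_S from Literature.Barriers.CriticalPhenomena.PlaquetteWalkHoleRootRowLaw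
open private fc_sOut_pred_of_sIn_S fc_sOut_pred_of_sIn_N from Literature.Barriers.CriticalPhenomena.PlaquetteWalkStraightRuns

variable {D : Set Face} {w r : Face} {ω : ΩG D (w.side .W) r}

set_option maxHeartbeats 400000 in -- one theorem, ≈ 1 100 tactic lines (200 000 does not suffice)
/-- ★★★ **THE FRAME DATA OF A COST-`7` PARENT ABOVE THE ROOT ROW, END SIDE `W`**: for a wound class-`B2a` walk of limit cost `7` from the hole root `w.side W`
at a rhombus `r` strictly above the root row with `w.1 ≤ r.1`, ending on the `W` side of `r` with a turning first arc in `r`, whose arcs `0, …, k − 1` are straight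
and whose arc `k` turns: the first arc in `r` is `S → E`, the arc `k` is `W → N` and comes strictly before the first hit, every other arc before the first hit is
straight, and any two different arcs in one plaquette lie in `p₁ = (w.1 + k, w.2)` and are `W → N` and `E → S`.
[cite: GlazmanManolescu2019, §1, Fig. 1 and eq. (1); Lemma 2.1; Remark 2.2] [cite: Glazman2015WeightedSAW, Lemma 3.1 (proof, pp. 6–7)]
[cite: CourantRobbins1958, Ch. V Appendix §2 (the even–odd rule)] -/
theorem frame_of_cost_seven_W_above (hh : holeFaceW w ∉ D) (hr : RootedFace D (w.side .W) r) (h : ω.IsB2a)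
    (hA : ω.AJ hr h (toC (midPt (w.side .W))) ≠ 0) (hc : cost (slotOfSide ω.1) ω.2.mids = 7) (hWz : ω.1 = .W)
    (hNS : arcKind (ω.2.sIn ω.2.firstHitG) (ω.2.sOut ω.2.firstHitG) ≠ .straight) (habove : w.2 < r.2) (hcol : w.1 ≤ r.1)
    {k : ℕ} (hk : k < ω.2.arcs.length) (hstrk : ∀ i < k, arcKind (ω.2.sIn i) (ω.2.sOut i) = .straight)
    (hturnk : arcKind (ω.2.sIn k) (ω.2.sOut k) ≠ .straight) :
    ω.2.sIn ω.2.firstHitG = .S ∧ ω.2.sOut ω.2.firstHitG = .E ∧ ω.2.sIn k = .W ∧ ω.2.sOut k = .N ∧ k < ω.2.firstHitG ∧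
      (∀ i < ω.2.firstHitG, i ≠ k → arcKind (ω.2.sIn i) (ω.2.sOut i) = .straight) ∧
      (∀ i j : ℕ, i < ω.2.arcs.length → j < ω.2.arcs.length → ω.2.fc i = ω.2.fc j → i ≠ j →
        ω.2.fc i = (w.1 + k, w.2) ∧
          ((ω.2.sIn i = .W ∧ ω.2.sOut i = .N ∧ ω.2.sIn j = .E ∧ ω.2.sOut j = .S) ∨
            (ω.2.sIn i = .E ∧ ω.2.sOut i = .S ∧ ω.2.sIn j = .W ∧ ω.2.sOut j = .N))) := by
  classical
  set n := ω.2.arcs.length with hn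
  have hz : ω.1 = .E ∨ ω.1 = .W := Or.inr hWz
  ---------------------------------------------------------------- counts: six isolated turns
  have hd : slotDeg (slotOfSide ω.1) = 0 := by rw [hWz]; rfl
  have h6 : cfgCount ω.2.mids [.corner] + cfgCount ω.2.mids [.coCorner] = 6 := by
    have hcost : cost (slotOfSide ω.1) ω.2.mids =
        cfgCount ω.2.mids [.corner] + cfgCount ω.2.mids [.coCorner] + (1 - slotDeg (slotOfSide ω.1)) := rfl
    rw [hcost, hd] at hc; omega
  let P : Face → Prop := fun f => f ∈ facesL ω.2.mids ∧ (kindsL ω.2.mids f = [.corner] ∨ kindsL ω.2.mids f = [.coCorner])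
  have hPiso : ∀ k < n, (∀ l < n, ω.2.fc l = ω.2.fc k → l = k) → arcKind (ω.2.sIn k) (ω.2.sOut k) ≠ .straight → P (ω.2.fc k) :=
    fun k hk hsv hkind => isolated_turn hk hsv hkind
  have hle6 : ∀ T : Finset Face, (∀ f ∈ T, P f) → T.card ≤ 6 := by
    intro T hT; have := YBWalk.card_le_cfgCount_add ω.2.mids T hT; omega
  have hPD : ∀ f s, ω.2.UsesSide f s → f ∈ D := by
    rintro f s ⟨i, hi, hfi, -⟩; rw [← hfi]; exact (YBWalk.arcFace_arcAt hi).2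
  ---------------------------------------------------------------- basics
  have hF := ω.fh_lt h
  have hlen : 0 < n := by omega
  have h0w : ω.2.fc 0 = w := fc_zero_eq_root w hh ω.2 hlen
  have h0W : ω.2.sIn 0 = .W := YBWalk.sIn_zero_eq_W hh ω.2 hlen
  have h0E : ω.2.sIn 0 ≠ .E := by rw [h0W]; decide
  have h0S : ω.2.sIn 0 ≠ .S := by rw [h0W]; decide
  have h0N : ω.2.sIn 0 ≠ .N := by rw [h0W]; decide
  obtain ⟨hzE, hfcZ⟩ : ω.2.sOut (n - 1) = .E ∧ ω.2.fc (n - 1) = (r.1 - 1, r.2) := by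
    rcases last_of_vertical_end hr h hz with ⟨hE', -, -⟩ | ⟨-, h1, h2⟩
    · rw [hWz] at hE'; exact absurd hE' (by decide)
    · exact ⟨h1, h2⟩
  have hzW' : ω.2.sOut (n - 1) ≠ .W := by rw [hzE]; decide
  have hzS' : ω.2.sOut (n - 1) ≠ .S := by rw [hzE]; decide
  have hzN' : ω.2.sOut (n - 1) ≠ .N := by rw [hzE]; decide
  have hfne3 : ω.2.firstHitG + 3 ≤ n := by have := three_le_Mv hr h; have := fh_add_Mv h; unfold ΩG.Mv at *; omega
  have hfcF := (fc_fh ω hr h).1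
  have hsvr : ∀ l < n, ω.2.fc l = ω.2.fc ω.2.firstHitG → l = ω.2.firstHitG := fun l hl e => eq_firstHitG_of_fc_eq hr h hl e
  have hPr : P r := by rw [← hfcF]; exact hPiso _ hF hsvr hNS
  have hrside : ∀ s, ω.2.UsesSide r s → r.side s ≠ r.side ω.1 := by
    rintro s ⟨l, hl, hfl, hs⟩ e
    have hl' := hsvr l hl (hfl.trans hfcF.symm)
    obtain ⟨hin, hout⟩ := ω.2.side_sIn_eq_nth hl
    rw [hfl] at hin hout
    rw [← ω.2.nth_length] at e
    rcases hs with hs | hs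
    · rw [hs] at hin; have := ω.2.nth_inj (show l ≤ n by omega) le_rfl (hin.symm.trans e).symm.symm; omega
    · rw [hs] at hout; have := ω.2.nth_inj (show l + 1 ≤ n by omega) le_rfl (hout.symm.trans e).symm.symm; omega
  have hrW : ¬ω.2.UsesSide r .W := fun hu => hrside .W hu (by rw [hWz])
  have hneF := ω.2.sIn_ne_sOut hF
  obtain ⟨X, hXw, hX, -⟩ := exists_left_entry_turn hh hr h hA
  obtain ⟨X', -, hX', -⟩ := exists_right_entry_turn hh hr h
  -- the first turn comes at or before the first hit, and strictly before it (`p₁` lies in the root row, `r` above it)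
  have hkF : k ≤ ω.2.firstHitG := by
    by_contra hlt
    exact hNS (hstrk _ (by omega))
  -- a turning arc uses a horizontal side and a vertical side
  have hHor : ∀ i < n, arcKind (ω.2.sIn i) (ω.2.sOut i) ≠ .straight → ω.2.UsesSide (ω.2.fc i) .W ∨ ω.2.UsesSide (ω.2.fc i) .E := by
    intro i hi hk'
    have hne := ω.2.sIn_ne_sOut hi
    have key : (ω.2.sIn i = .W ∨ ω.2.sOut i = .W) ∨ (ω.2.sIn i = .E ∨ ω.2.sOut i = .E) := by
      revert hne hk'; cases ω.2.sIn i <;> cases ω.2.sOut i <;> decide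
    rcases key with hW | hEx
    · exact Or.inl ⟨i, hi, rfl, hW⟩
    · exact Or.inr ⟨i, hi, rfl, hEx⟩
  ---------------------------------------------------------------- the top row is `r.2`; the first arc uses `S` and `W`
  have htop := top_row_of_cost_seven_vert_above hh hr h hA hc hz hNS habove
  have hNtop := forall_top_ne_N hh hr h htop habove
  have hupN : ∀ f : Face, f.2 = r.2 → ¬ω.2.UsesSide f .N := by
    rintro f hf ⟨i, hi, hfi, hs | hs⟩
    · exact (hNtop i hi (by rw [hfi, hf])).1 hs
    · exact (hNtop i hi (by rw [hfi, hf])).2 hs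
  have hsvTop : ∀ i, i < n → (ω.2.fc i).2 = r.2 → ∀ l < n, ω.2.fc l = ω.2.fc i → l = i :=
    fun i hi hrw l hl e => (top_single_visit hh hr h htop habove hi hl hrw e.symm).symm
  ---------------------------------------------------------------- the bottom turns and the root-row turn `τ`
  obtain ⟨Y', hY'w, hY', j₀, j₁, -, hj₀2, hrow₀', hN₀', hWE₀', hj₀₁, hj₁, hrow₁', hmax₁, halt'⟩ := bottom_exit_or_end hh hr h hA
  obtain ⟨hN₁', hWE₁', -, hfne'⟩ : (ω.2.sOut j₁ = .N ∧ (ω.2.sIn j₁ = .W ∨ ω.2.sIn j₁ = .E) ∧ j₀ ≠ j₁ ∧ ω.2.fc j₀ ≠ ω.2.fc j₁) := by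
    rcases halt' with hh' | ⟨-, -, hrY'⟩
    · exact hh'
    · exfalso; omega
  have hj₀ : j₀ < n := by omega
  have hsvB : ∀ k, k < n → (ω.2.fc k).2 = Y' → ∀ l < n, ω.2.fc l = ω.2.fc k → l = k :=
    fun k hk hrw l hl e => (bottom_single_visit hh hr h hY' (by omega) hk hl hrw e.symm).symm
  have hbotS := forall_bottom_ne_S hh hr h hY' (by omega)
  have hPb₀ : P (ω.2.fc j₀) := hPiso j₀ hj₀ (hsvB j₀ hj₀ hrow₀') (by rw [hN₀']; exact YBWalk.arcKind_ne_straight_of_S_WE (Or.inr rfl) hWE₀')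
  have hPb₁ : P (ω.2.fc j₁) := hPiso j₁ hj₁ (hsvB j₁ hj₁ hrow₁') (by rw [hN₁']; exact YBWalk.arcKind_ne_straight_of_WE_S hWE₁' (Or.inr rfl))
  -- the first turn `p₁ = (w.1 + k, w.2)`
  have hk₁ : k < n := hk
  have hstr := hstrk
  obtain ⟨hrun, hrunE⟩ := ω.2.initial_run hh hk₁ hstr
  obtain ⟨hfk, hWk⟩ := hrun k le_rfl
  have hp₁W : ω.2.UsesSide (w.1 + k, w.2) .W := ⟨k, hk₁, hfk, Or.inl hWk⟩
  have hkEo : ω.2.sOut k ≠ .E := by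
    intro e; apply hturnk; rw [hWk, e]; decide
  have hkNS : ω.2.sOut k = .N ∨ ω.2.sOut k = .S := by
    have hne := ω.2.sIn_ne_sOut hk₁
    rw [hWk] at hne
    revert hkEo hne; cases ω.2.sOut k <;> decide
  have hkltF : k < ω.2.firstHitG := by
    rcases lt_or_eq_of_le hkF with hlt | heq
    · exact hlt
    · exfalso
      have e : (((w.1 : ℤ) + k, w.2) : Face) = r := by rw [← hfk, heq, hfcF]
      have := congrArg Prod.snd e; simp only at this; omega
  obtain ⟨τ1, hPτ, hτ1, hτW, hτnE, hτalt⟩ : ∃ τ1 : ℤ, P (τ1, w.2) ∧ w.1 + k ≤ τ1 ∧ ω.2.UsesSide (τ1, w.2) .W ∧ ¬ω.2.UsesSide (τ1, w.2) .E ∧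
      ((τ1 = w.1 + k ∧ ¬ω.2.UsesSide (w.1 + k, w.2) .E) ∨
        (w.1 + k < τ1 ∧ ω.2.UsesSide (w.1 + k, w.2) .E ∧ (∀ m : ℕ, 1 ≤ m → (m : ℤ) ≤ τ1 - (w.1 + k) → ω.2.UsesSide (w.1 + k + m, w.2) .W) ∧
          ∀ m : ℕ, (m : ℤ) < τ1 - (w.1 + k) → ω.2.UsesSide (w.1 + k + m, w.2) .E)) := by
    by_cases hpE : ω.2.UsesSide (w.1 + k, w.2) .E
    · obtain ⟨M, hWall, hEall', hend⟩ := ω.2.chain_E hX' hpE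
      rcases hend with ⟨hM1, hnot⟩ | ⟨-, hs0⟩ | ⟨hZ, -⟩
      · obtain ⟨i', hi', hfc', hsv', -, -, -, hk'⟩ := ω.2.isolated_of_usesSide_not_opp (hWall M hM1 le_rfl) hnot
        refine ⟨w.1 + k + M, ?_, by omega, hWall M hM1 le_rfl, hnot,
          Or.inr ⟨by omega, hpE, fun m hm1 hm2 => hWall m hm1 (by omega), fun m hm => hEall' m (by omega)⟩⟩
        have := hPiso i' hi' hsv' hk'; rw [hfc'] at this; exact this
      · exact absurd hs0 h0E
      · rw [hfcZ] at hZ; have := congrArg Prod.snd hZ; simp only at this; omega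
    · obtain ⟨i', hi', hfc', hsv', -, -, -, hk'⟩ := ω.2.isolated_of_usesSide_not_opp hp₁W hpE
      refine ⟨w.1 + k, ?_, le_rfl, hp₁W, hpE, Or.inl ⟨rfl, hpE⟩⟩
      have := hPiso i' hi' hsv' hk'; rw [hfc'] at this; exact this
  -- `τ` is singly visited
  have hsvτ : ∀ i, i < n → ω.2.fc i = ((τ1 : ℤ), w.2) → ∀ l < n, ω.2.fc l = ((τ1 : ℤ), w.2) → l = i :=
    fun i hi hfi l hl hfl => ω.2.single_visit_of_not_usesSide hτnE hl hi hfl hfi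
  ---------------------------------------------------------------- the first arc in `r` uses `S` and `E`; the east turn `t'` of `r`'s top-row chain
  obtain ⟨hSr, hnN1, hnN2⟩ := usesSide_S_of_cost_seven_vert_above hh hr h hA hc hz hNS habove
  have hnW1 : ω.2.sIn ω.2.firstHitG ≠ .W := fun e => hrW ⟨_, hF, hfcF, Or.inl e⟩
  have hnW2 : ω.2.sOut ω.2.firstHitG ≠ .W := fun e => hrW ⟨_, hF, hfcF, Or.inr e⟩
  have hkey : (ω.2.sIn ω.2.firstHitG = .S ∧ ω.2.sOut ω.2.firstHitG = .E) ∨ (ω.2.sIn ω.2.firstHitG = .E ∧ ω.2.sOut ω.2.firstHitG = .S) := by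
    revert hSr hnN1 hnN2 hnW1 hnW2 hneF; cases ω.2.sIn ω.2.firstHitG <;> cases ω.2.sOut ω.2.firstHitG <;> decide
  have hrUE : ω.2.UsesSide r .E := by
    rcases hkey with ⟨-, h2⟩ | ⟨h1, -⟩
    · exact ⟨_, hF, hfcF, Or.inr h2⟩
    · exact ⟨_, hF, hfcF, Or.inl h1⟩
  have hrUS : ω.2.UsesSide r .S := ⟨_, hF, hfcF, hSr⟩
  obtain ⟨M, hWall, hEall, hend⟩ := ω.2.chain_E hX' hrUE
  obtain ⟨hM1, hnotE⟩ : 1 ≤ M ∧ ¬ω.2.UsesSide (r.1 + M, r.2) .E := by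
    rcases hend with hT | ⟨-, hs0⟩ | ⟨hZ, -⟩
    · exact hT
    · exact absurd hs0 h0E
    · rw [hfcZ] at hZ; have := congrArg Prod.fst hZ; simp only at this; omega
  obtain ⟨iT, hiT, hfcT, hsvT, hWT, hninT, hnoutT, hkT⟩ := ω.2.isolated_of_usesSide_not_opp (hWall M hM1 le_rfl) hnotE
  have hPt : P (r.1 + M, r.2) := by rw [← hfcT]; exact hPiso iT hiT hsvT hkT
  ---------------------------------------------------------------- at most ONE isolated turn besides `t, r, b₀, b₁, τ`
  have hne_of_row : ∀ f g : Face, f.2 ≠ g.2 → f ≠ g := fun f g hfg e => hfg (by rw [e])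
  have houts : ∀ g₁ g₂ : Face, P g₁ → P g₂ → g₁ ≠ g₂ →
      g₁ ≠ ((r.1 : ℤ) + M, r.2) → g₁ ≠ r → g₁ ≠ ω.2.fc j₀ → g₁ ≠ ω.2.fc j₁ → g₁ ≠ ((τ1 : ℤ), w.2) →
      g₂ ≠ ((r.1 : ℤ) + M, r.2) → g₂ ≠ r → g₂ ≠ ω.2.fc j₀ → g₂ ≠ ω.2.fc j₁ → g₂ ≠ ((τ1 : ℤ), w.2) → False := by
    intro g₁ g₂ hg₁ hg₂ hne a1 a2 a3 a4 a5 c1 c2 c3 c4 c5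
    have hT : ∀ x ∈ ({((r.1 : ℤ) + M, r.2), r, ω.2.fc j₀, ω.2.fc j₁, ((τ1 : ℤ), w.2), g₁, g₂} : Finset Face), P x := by
      intro x hx
      simp only [Finset.mem_insert, Finset.mem_singleton] at hx
      rcases hx with rfl | rfl | rfl | rfl | rfl | rfl | rfl
      exacts [hPt, hPr, hPb₀, hPb₁, hPτ, hg₁, hg₂]
    have n01 : (((r.1 : ℤ) + M, r.2) : Face) ≠ r := by intro e; have := congrArg Prod.fst e; simp only at this; omega
    have n02 := hne_of_row ((r.1 : ℤ) + M, r.2) (ω.2.fc j₀) (by rw [hrow₀']; simp only; omega)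
    have n03 := hne_of_row ((r.1 : ℤ) + M, r.2) (ω.2.fc j₁) (by rw [hrow₁']; simp only; omega)
    have n04 := hne_of_row ((r.1 : ℤ) + M, r.2) ((τ1 : ℤ), w.2) (by simp only; omega)
    have n12 := hne_of_row r (ω.2.fc j₀) (by rw [hrow₀']; omega)
    have n13 := hne_of_row r (ω.2.fc j₁) (by rw [hrow₁']; omega)
    have n14 := hne_of_row r ((τ1 : ℤ), w.2) (by simp only; omega)
    have n23 := hfne'
    have n24 := hne_of_row (ω.2.fc j₀) ((τ1 : ℤ), w.2) (by rw [hrow₀']; simp only; omega)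
    have n34 := hne_of_row (ω.2.fc j₁) ((τ1 : ℤ), w.2) (by rw [hrow₁']; simp only; omega)
    have hcard : ({((r.1 : ℤ) + M, r.2), r, ω.2.fc j₀, ω.2.fc j₁, ((τ1 : ℤ), w.2), g₁, g₂} : Finset Face).card = 7 := by
      rw [Finset.card_insert_of_notMem (by simp only [Finset.mem_insert, Finset.mem_singleton, not_or]; exact ⟨n01, n02, n03, n04, a1.symm, c1.symm⟩),
        Finset.card_insert_of_notMem (by simp only [Finset.mem_insert, Finset.mem_singleton, not_or]; exact ⟨n12, n13, n14, a2.symm, c2.symm⟩),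
        Finset.card_insert_of_notMem (by simp only [Finset.mem_insert, Finset.mem_singleton, not_or]; exact ⟨n23, n24, a3.symm, c3.symm⟩),
        Finset.card_insert_of_notMem (by simp only [Finset.mem_insert, Finset.mem_singleton, not_or]; exact ⟨n34, a4.symm, c4.symm⟩),
        Finset.card_insert_of_notMem (by simp only [Finset.mem_insert, Finset.mem_singleton, not_or]; exact ⟨a5.symm, c5.symm⟩),
        Finset.card_insert_of_notMem (by simp only [Finset.mem_singleton]; exact hne), Finset.card_singleton]
    have := hle6 _ hT
    omega
  -- an isolated turn of the root row west of the hole, or of a middle row, is an "outsider"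
  have hout_row : ∀ g : Face, g.2 = w.2 → g.1 < w.1 →
      g ≠ ((r.1 : ℤ) + M, r.2) ∧ g ≠ r ∧ g ≠ ω.2.fc j₀ ∧ g ≠ ω.2.fc j₁ ∧ g ≠ ((τ1 : ℤ), w.2) := by
    intro g hg2 hg1
    refine ⟨hne_of_row _ _ (by rw [hg2]; simp only; omega), hne_of_row _ _ (by rw [hg2]; omega),
      hne_of_row _ _ (by rw [hg2, hrow₀']; omega), hne_of_row _ _ (by rw [hg2, hrow₁']; omega), ?_⟩
    intro e; have := congrArg Prod.fst e; simp only at this; omega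
  have hout_mid : ∀ g : Face, w.2 < g.2 → g.2 < r.2 →
      g ≠ ((r.1 : ℤ) + M, r.2) ∧ g ≠ r ∧ g ≠ ω.2.fc j₀ ∧ g ≠ ω.2.fc j₁ ∧ g ≠ ((τ1 : ℤ), w.2) := by
    intro g h1 h2
    exact ⟨hne_of_row _ _ (by simp only; omega), hne_of_row _ _ (by omega), hne_of_row _ _ (by rw [hrow₀']; omega),
      hne_of_row _ _ (by rw [hrow₁']; omega), hne_of_row _ _ (by simp only; omega)⟩
  have hout_low : ∀ g : Face, Y' < g.2 → g.2 < w.2 →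
      g ≠ ((r.1 : ℤ) + M, r.2) ∧ g ≠ r ∧ g ≠ ω.2.fc j₀ ∧ g ≠ ω.2.fc j₁ ∧ g ≠ ((τ1 : ℤ), w.2) := by
    intro g h1 h2
    exact ⟨hne_of_row _ _ (by simp only; omega), hne_of_row _ _ (by omega), hne_of_row _ _ (by rw [hrow₀']; omega),
      hne_of_row _ _ (by rw [hrow₁']; omega), hne_of_row _ _ (by simp only; omega)⟩
  -- an isolated turn of the top row east of `r` is an outsider
  have hout_top : ∀ g : Face, g.2 = r.2 → g.1 < r.1 →
      g ≠ ((r.1 : ℤ) + M, r.2) ∧ g ≠ r ∧ g ≠ ω.2.fc j₀ ∧ g ≠ ω.2.fc j₁ ∧ g ≠ ((τ1 : ℤ), w.2) := by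
    intro g hg2 hg1
    refine ⟨fun e => ?_, fun e => ?_, hne_of_row _ _ (by rw [hg2, hrow₀']; omega), hne_of_row _ _ (by rw [hg2, hrow₁']; omega),
      hne_of_row _ _ (by rw [hg2]; simp only; omega)⟩
    · have := congrArg Prod.fst e; simp only at this; omega
    · have := congrArg Prod.fst e; omega
  ---------------------------------------------------------------- chain ends, packaged
  have hEend : ∀ x y : ℤ, ω.2.UsesSide (x, y) .E → y ≠ r.2 → ∃ Mh : ℕ, 1 ≤ Mh ∧ P (x + Mh, y) ∧
      (∀ m : ℕ, 1 ≤ m → m ≤ Mh → ω.2.UsesSide (x + m, y) .W) ∧ (∀ m : ℕ, m < Mh → ω.2.UsesSide (x + m, y) .E) ∧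
      ¬ω.2.UsesSide (x + Mh, y) .E := by
    intro x y hEx hyr
    obtain ⟨Mh, hW', hE', hend'⟩ := ω.2.chain_E hX' hEx
    rcases hend' with ⟨hM1', hnot⟩ | ⟨-, hs0⟩ | ⟨hZ, -⟩
    · obtain ⟨i, hi, hfci, hsv, -, -, -, hk'⟩ := ω.2.isolated_of_usesSide_not_opp (hW' Mh hM1' le_rfl) hnot
      exact ⟨Mh, hM1', by rw [← hfci]; exact hPiso i hi hsv hk', hW', hE', hnot⟩
    · exact absurd hs0 h0E
    · rw [hfcZ] at hZ; have := congrArg Prod.snd hZ; simp only at this; exact absurd this hyr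
  have hWend : ∀ x y : ℤ, ω.2.UsesSide (x, y) .W → y ≠ w.2 → y ≠ r.2 → ∃ Mh : ℕ, 1 ≤ Mh ∧ P (x - Mh, y) ∧
      (∀ m : ℕ, 1 ≤ m → m ≤ Mh → ω.2.UsesSide (x - m, y) .E) ∧ (∀ m : ℕ, m < Mh → ω.2.UsesSide (x - m, y) .W) ∧
      ¬ω.2.UsesSide (x - Mh, y) .W := by
    intro x y hW hyw hyr
    obtain ⟨Mh, hE', hW', hend'⟩ := ω.2.chain_W hX hW
    rcases hend' with ⟨hM1', hnot⟩ | ⟨hA0, -⟩ | ⟨-, hsZ⟩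
    · obtain ⟨i, hi, hfci, hsv, -, -, -, hk'⟩ := ω.2.isolated_of_usesSide_not_opp (hE' Mh hM1' le_rfl) hnot
      exact ⟨Mh, hM1', by rw [← hfci]; exact hPiso i hi hsv hk', hE', hW', hnot⟩
    · rw [h0w] at hA0; have := congrArg Prod.snd hA0; simp only at this; exact absurd this hyw
    · exact absurd hsZ hzW'
  have hNend : ∀ x y : ℤ, ω.2.UsesSide (x, y) .N → ∃ Mv : ℕ, 1 ≤ Mv ∧ y + Mv ≤ r.2 ∧ P (x, y + Mv) ∧
      (∀ m : ℕ, 1 ≤ m → m ≤ Mv → ω.2.UsesSide (x, y + m) .S) ∧ (∀ m : ℕ, m < Mv → ω.2.UsesSide (x, y + m) .N) ∧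
      ¬ω.2.UsesSide (x, y + Mv) .N ∧ (ω.2.UsesSide (x, y + Mv) .W ∨ ω.2.UsesSide (x, y + Mv) .E) ∧
      ∃ i < n, ω.2.fc i = (x, y + Mv) ∧ (∀ l < n, ω.2.fc l = ω.2.fc i → l = i) ∧ (ω.2.sIn i = .S ∨ ω.2.sOut i = .S) ∧
        arcKind (ω.2.sIn i) (ω.2.sOut i) ≠ .straight := by
    intro x y hN
    obtain ⟨Mv, hS', hN', hend'⟩ := ω.2.chain_N htop hN
    obtain ⟨hM1', hnot⟩ : 1 ≤ Mv ∧ ¬ω.2.UsesSide (x, y + Mv) .N := by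
      rcases hend' with hT | ⟨-, hs0⟩ | ⟨-, hsZ⟩
      · exact hT
      · exact absurd hs0 h0N
      · exact absurd hsZ hzN'
    obtain ⟨i, hi, hfci, hsv, hSi, -, -, hk'⟩ := ω.2.isolated_of_usesSide_not_opp (hS' Mv hM1' le_rfl) hnot
    refine ⟨Mv, hM1', ?_, ?_, hS', hN', hnot, ?_, i, hi, hfci, hsv, hSi, hk'⟩
    · have := htop i hi; rw [hfci] at this; exact this
    · rw [← hfci]; exact hPiso i hi hsv hk'
    · rw [← hfci]; exact hHor i hi hk'
  have hSend : ∀ x y : ℤ, ω.2.UsesSide (x, y) .S → ∃ Mv : ℕ, 1 ≤ Mv ∧ Y' ≤ y - Mv ∧ P (x, y - Mv) ∧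
      (∀ m : ℕ, 1 ≤ m → m ≤ Mv → ω.2.UsesSide (x, y - m) .N) ∧ (∀ m : ℕ, m < Mv → ω.2.UsesSide (x, y - m) .S) ∧
      ¬ω.2.UsesSide (x, y - Mv) .S ∧ (ω.2.UsesSide (x, y - Mv) .W ∨ ω.2.UsesSide (x, y - Mv) .E) ∧
      ∃ i < n, ω.2.fc i = (x, y - Mv) ∧ (∀ l < n, ω.2.fc l = ω.2.fc i → l = i) ∧ (ω.2.sIn i = .N ∨ ω.2.sOut i = .N) ∧
        arcKind (ω.2.sIn i) (ω.2.sOut i) ≠ .straight := by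
    intro x y hS
    obtain ⟨Mv, hN', hS', hend'⟩ := ω.2.chain_S hY' hS
    obtain ⟨hM1', hnot⟩ : 1 ≤ Mv ∧ ¬ω.2.UsesSide (x, y - Mv) .S := by
      rcases hend' with hT | ⟨-, hs0⟩ | ⟨-, hsZ⟩
      · exact hT
      · exact absurd hs0 h0S
      · exact absurd hsZ hzS'
    obtain ⟨i, hi, hfci, hsv, hNi, -, -, hk'⟩ := ω.2.isolated_of_usesSide_not_opp (hN' Mv hM1' le_rfl) hnot
    refine ⟨Mv, hM1', ?_, ?_, hN', hS', hnot, ?_, i, hi, hfci, hsv, hNi, hk'⟩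
    · have := hY' i hi; rw [hfci] at this; exact this
    · rw [← hfci]; exact hPiso i hi hsv hk'
    · rw [← hfci]; exact hHor i hi hk'
  ---------------------------------------------------------------- outsider killers
  -- a horizontal chain from an isolated turn `g` of a row strictly between the bottom row and the top row, other than the root row, ends at a second outsider
  have hmid_kill : ∀ (g : Face), P g → Y' < g.2 → g.2 < r.2 → g.2 ≠ w.2 → (ω.2.UsesSide g .W ∨ ω.2.UsesSide g .E) → False := by
    intro g hPg h1 h2 h3 hgEW
    have hog : ∀ g' : Face, g'.2 = g.2 →
        g' ≠ ((r.1 : ℤ) + M, r.2) ∧ g' ≠ r ∧ g' ≠ ω.2.fc j₀ ∧ g' ≠ ω.2.fc j₁ ∧ g' ≠ ((τ1 : ℤ), w.2) := by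
      intro g' hg'
      rcases lt_or_gt_of_ne h3 with hl | hg
      · exact hout_low g' (by omega) (by omega)
      · exact hout_mid g' (by omega) (by omega)
    obtain ⟨p1, p2, p3, p4, p5⟩ := hog g rfl
    rcases hgEW with hW | hEx
    · obtain ⟨M₁, hM₁, hP₁, -, -, -⟩ := hWend g.1 g.2 hW h3 (by omega)
      obtain ⟨c1, c2, c3, c4, c5⟩ := hog (g.1 - M₁, g.2) rfl
      exact houts _ _ hPg hP₁ (fun e => by have := congrArg Prod.fst e; simp only at this; omega) p1 p2 p3 p4 p5 c1 c2 c3 c4 c5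
    · obtain ⟨M₂, hM₂, hP₂, -, -, -⟩ := hEend g.1 g.2 hEx (by omega)
      obtain ⟨c1, c2, c3, c4, c5⟩ := hog (g.1 + M₂, g.2) rfl
      exact houts _ _ hPg hP₂ (fun e => by have := congrArg Prod.fst e; simp only at this; omega) p1 p2 p3 p4 p5 c1 c2 c3 c4 c5
  -- hence no plaquette of such a row with a `W`-chain: its end would be such a turn
  have hWkill : ∀ x y : ℤ, ω.2.UsesSide (x, y) .W → Y' < y → y < r.2 → y ≠ w.2 → False := by
    intro x y hW h1 h2 h3
    obtain ⟨M₁, hM₁, hP₁, hE₁, -, -⟩ := hWend x y hW h3 (by omega)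
    exact hmid_kill _ hP₁ h1 h2 h3 (Or.inr (hE₁ M₁ hM₁ le_rfl))
  -- and a vertical chain end strictly inside such a row is impossible
  have hNtop_of : ∀ x y : ℤ, ∀ Mv : ℕ, P (x, y + Mv) → w.2 ≤ y → y + Mv ≤ r.2 →
      (ω.2.UsesSide (x, y + Mv) .W ∨ ω.2.UsesSide (x, y + Mv) .E) → 1 ≤ Mv → y + Mv = r.2 := by
    intro x y Mv hP hy hle hU hM
    rcases lt_or_eq_of_le hle with hlt | heq
    · exact (hmid_kill _ hP (by simp only; omega) (by simp only; exact hlt) (by simp only; omega) hU).elim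
    · exact heq
  have hSbot_of : ∀ x y : ℤ, ∀ Mv : ℕ, P (x, y - Mv) → y ≤ w.2 → Y' ≤ y - Mv →
      (ω.2.UsesSide (x, y - Mv) .W ∨ ω.2.UsesSide (x, y - Mv) .E) → 1 ≤ Mv → y - Mv = Y' := by
    intro x y Mv hP hy hle hU hM
    rcases lt_or_eq_of_le hle with hlt | heq
    · exact (hmid_kill _ hP (by simp only; exact hlt) (by simp only; omega) (by simp only; omega) hU).elim
    · exact heq.symm
  -- no plaquette of a middle row uses `E` either
  have hEkill : ∀ x y : ℤ, ω.2.UsesSide (x, y) .E → Y' < y → y < r.2 → y ≠ w.2 → False := by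
    intro x y hEx h1 h2 h3
    obtain ⟨M₁, hM₁, hP₁, hW₁, -, -⟩ := hEend x y hEx (by omega)
    exact hmid_kill _ hP₁ h1 h2 h3 (Or.inl (hW₁ M₁ hM₁ le_rfl))
  ---------------------------------------------------------------- the sixth isolated turn: the top `ξ₀` of the column above the excursion's arc on the western ray
  obtain ⟨i', hi'F, hi'n, hrowP, hcolP, hSP⟩ := exists_arc_west_rootRow_after_fh hh hr h hA hcol
  set x₀ := (ω.2.fc i').1 with hx₀
  have hfcP : ω.2.fc i' = (x₀, w.2) := Prod.ext rfl hrowP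
  -- the horizontal chains of a root-row plaquette west of the hole end at outsiders west of the hole
  have hWend0 : ∀ x : ℤ, x ≤ w.1 - 2 → ω.2.UsesSide (x, w.2) .W → ∃ g : Face, P g ∧ g.2 = w.2 ∧ g.1 < x := by
    intro x hx hW
    obtain ⟨M₁, hE₁, -, hend₁⟩ := ω.2.chain_W hX hW
    rcases hend₁ with ⟨hM1', hnot⟩ | ⟨hA0, -⟩ | ⟨-, hsZ⟩
    · obtain ⟨i₁, hi₁, hfc₁, hsv₁, -, -, -, hk₁'⟩ := ω.2.isolated_of_usesSide_not_opp (hE₁ M₁ hM1' le_rfl) hnot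
      refine ⟨((x : ℤ) - M₁, w.2), ?_, rfl, by simp only; omega⟩
      show P ((((x : ℤ), w.2) : Face).1 - (M₁ : ℤ), (((x : ℤ), w.2) : Face).2)
      rw [← hfc₁]; exact hPiso i₁ hi₁ hsv₁ hk₁'
    · rw [h0w] at hA0; have := congrArg Prod.fst hA0; simp only at this; omega
    · exact absurd hsZ hzW'
  have hEend0 : ∀ x : ℤ, x ≤ w.1 - 2 → ω.2.UsesSide (x, w.2) .E → ∃ g : Face, P g ∧ g.2 = w.2 ∧ x < g.1 ∧ g.1 ≤ w.1 - 2 := by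
    intro x hx hEx
    obtain ⟨M₂, hW₂, -, hend₂⟩ := ω.2.chain_E hX' hEx
    have hhole : ∀ m : ℕ, 1 ≤ m → m ≤ M₂ → x + m ≠ w.1 - 1 := by
      intro m hm1 hm2 e
      have hD := hPD _ _ (hW₂ m hm1 hm2)
      simp only at hD
      rw [e] at hD
      exact hh (by simpa [holeFaceW] using hD)
    have hM₂w : x + M₂ ≤ w.1 - 2 := by
      by_contra hlt
      exact hhole (w.1 - 1 - x).toNat (by omega) (by omega) (by omega)
    rcases hend₂ with ⟨hM1', hnot⟩ | ⟨hA0, -⟩ | ⟨hZ, -⟩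
    · obtain ⟨i₁, hi₁, hfc₁, hsv₁, -, -, -, hk₁'⟩ := ω.2.isolated_of_usesSide_not_opp (hW₂ M₂ hM1' le_rfl) hnot
      refine ⟨((x : ℤ) + M₂, w.2), ?_, rfl, by simp only; omega, by simp only; omega⟩
      show P ((((x : ℤ), w.2) : Face).1 + (M₂ : ℤ), (((x : ℤ), w.2) : Face).2)
      rw [← hfc₁]; exact hPiso i₁ hi₁ hsv₁ hk₁'
    · rw [h0w] at hA0; have := congrArg Prod.fst hA0; simp only at this; omega
    · rw [hfcZ] at hZ; have := congrArg Prod.snd hZ; simp only at this; omega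
  -- `P₀` is singly visited and straight, so it uses `N` and `S`
  have hPsv : ∀ l < n, ω.2.fc l = ω.2.fc i' → l = i' := by
    intro l hl hfl
    by_contra hne
    have hall : ∀ s, ω.2.UsesSide (x₀, w.2) s := fun s => by
      rw [← hfcP]; exact ω.2.usesSide_of_fc_eq hi'n hl (Ne.symm hne) hfl.symm s
    obtain ⟨g₁, hPg₁, hg₁2, hg₁1⟩ := hWend0 x₀ hcolP (hall .W)
    obtain ⟨g₂, hPg₂, hg₂2, hg₂1, hg₂w⟩ := hEend0 x₀ hcolP (hall .E)
    obtain ⟨a1, a2, a3, a4, a5⟩ := hout_row g₁ hg₁2 (by omega)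
    obtain ⟨c1, c2, c3, c4, c5⟩ := hout_row g₂ hg₂2 (by omega)
    exact houts g₁ g₂ hPg₁ hPg₂ (fun e => by have := congrArg Prod.fst e; omega) a1 a2 a3 a4 a5 c1 c2 c3 c4 c5
  have hPst : arcKind (ω.2.sIn i') (ω.2.sOut i') = .straight := by
    by_contra hk'
    have hPP : P (x₀, w.2) := by rw [← hfcP]; exact hPiso i' hi'n hPsv hk'
    obtain ⟨p1, p2, p3, p4, p5⟩ := hout_row (x₀, w.2) rfl (by simp only; omega)
    have hne' := ω.2.sIn_ne_sOut hi'n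
    have hEW : (ω.2.sIn i' = .W ∨ ω.2.sOut i' = .W) ∨ (ω.2.sIn i' = .E ∨ ω.2.sOut i' = .E) := by
      revert hSP hk' hne'; cases ω.2.sIn i' <;> cases ω.2.sOut i' <;> decide
    rcases hEW with hW | hEx
    · obtain ⟨g₁, hPg₁, hg₁2, hg₁1⟩ := hWend0 x₀ hcolP ⟨i', hi'n, hfcP, hW⟩
      obtain ⟨a1, a2, a3, a4, a5⟩ := hout_row g₁ hg₁2 (by omega)
      exact houts _ _ hPP hPg₁ (fun e => by have := congrArg Prod.fst e; simp only at this; omega) p1 p2 p3 p4 p5 a1 a2 a3 a4 a5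
    · obtain ⟨g₂, hPg₂, hg₂2, hg₂1, hg₂w⟩ := hEend0 x₀ hcolP ⟨i', hi'n, hfcP, hEx⟩
      obtain ⟨c1, c2, c3, c4, c5⟩ := hout_row g₂ hg₂2 (by omega)
      exact houts _ _ hPP hPg₂ (fun e => by have := congrArg Prod.fst e; simp only at this; omega) p1 p2 p3 p4 p5 c1 c2 c3 c4 c5
  have hPN : ω.2.UsesSide (x₀, w.2) .N := by
    have hout := ω.2.sOut_of_straight hi'n hPst
    have key : ω.2.sIn i' = .N ∨ ω.2.sOut i' = .N := by
      revert hSP hout; cases ω.2.sIn i' <;> cases ω.2.sOut i' <;> decide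
    exact ⟨i', hi'n, hfcP, key⟩
  have hPS : ω.2.UsesSide (x₀, w.2) .S := ⟨i', hi'n, hfcP, hSP⟩
  -- its column climbs to the top row: the outsider `ξ₀ = (x₀, r.2)`
  obtain ⟨Mξ, hMξ1, hξrow, hPξ, hSξ, hNξ, hnotNξ, hξUses, iξ, hiξ, hfcξ, hsvξ, hSiξ, hkξ⟩ := hNend x₀ w.2 hPN
  have hξtop : w.2 + (Mξ : ℤ) = r.2 := hNtop_of _ _ _ hPξ le_rfl hξrow hξUses hMξ1
  rw [hξtop] at hPξ hfcξ hnotNξ hξUses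
  obtain ⟨o1, o2, o3, o4, o5⟩ := hout_top (((x₀ : ℤ), r.2) : Face) rfl (by simp only; omega)
  ---------------------------------------------------------------- the budget is exhausted: no seventh isolated turn
  have hkill7 : ∀ g : Face, P g → g ≠ ((r.1 : ℤ) + M, r.2) → g ≠ r → g ≠ ω.2.fc j₀ → g ≠ ω.2.fc j₁ → g ≠ ((τ1 : ℤ), w.2) →
      g ≠ ((x₀ : ℤ), r.2) → False :=
    fun g hPg a1 a2 a3 a4 a5 a6 => houts _ _ hPg hPξ a6 a1 a2 a3 a4 a5 o1 o2 o3 o4 o5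
  -- no root-row plaquette west of the hole uses a horizontal side
  have hWwest : ∀ x : ℤ, x ≤ w.1 - 2 → ¬ω.2.UsesSide (x, w.2) .W := by
    intro x hx hW
    obtain ⟨g, hPg, hg2, hg1⟩ := hWend0 x hx hW
    obtain ⟨a1, a2, a3, a4, a5⟩ := hout_row g hg2 (by omega)
    exact hkill7 g hPg a1 a2 a3 a4 a5 (hne_of_row _ _ (by rw [hg2]; simp only; omega))
  have hEwest : ∀ x : ℤ, x ≤ w.1 - 2 → ¬ω.2.UsesSide (x, w.2) .E := by
    intro x hx hEx
    obtain ⟨g, hPg, hg2, hg1, hgw⟩ := hEend0 x hx hEx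
    obtain ⟨a1, a2, a3, a4, a5⟩ := hout_row g hg2 (by omega)
    exact hkill7 g hPg a1 a2 a3 a4 a5 (hne_of_row _ _ (by rw [hg2]; simp only; omega))
  -- so the arcs of the plaquettes off the three rows are vertical
  have hvertM : ∀ i < n, Y' < (ω.2.fc i).2 → (ω.2.fc i).2 < r.2 → (ω.2.fc i).2 ≠ w.2 →
      (ω.2.sIn i = .N ∧ ω.2.sOut i = .S) ∨ (ω.2.sIn i = .S ∧ ω.2.sOut i = .N) := by
    intro i hi h1 h2 h3
    have hW1 : ω.2.sIn i ≠ .W := fun e => hWkill (ω.2.fc i).1 (ω.2.fc i).2 ⟨i, hi, rfl, Or.inl e⟩ h1 h2 h3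
    have hW2 : ω.2.sOut i ≠ .W := fun e => hWkill (ω.2.fc i).1 (ω.2.fc i).2 ⟨i, hi, rfl, Or.inr e⟩ h1 h2 h3
    have hE1 : ω.2.sIn i ≠ .E := fun e => hEkill (ω.2.fc i).1 (ω.2.fc i).2 ⟨i, hi, rfl, Or.inl e⟩ h1 h2 h3
    have hE2 : ω.2.sOut i ≠ .E := fun e => hEkill (ω.2.fc i).1 (ω.2.fc i).2 ⟨i, hi, rfl, Or.inr e⟩ h1 h2 h3
    have hne := ω.2.sIn_ne_sOut hi
    revert hW1 hW2 hE1 hE2 hne; cases ω.2.sIn i <;> cases ω.2.sOut i <;> decide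
  have hvertW : ∀ i < n, (ω.2.fc i).2 = w.2 → (ω.2.fc i).1 ≤ w.1 - 2 →
      (ω.2.sIn i = .N ∧ ω.2.sOut i = .S) ∨ (ω.2.sIn i = .S ∧ ω.2.sOut i = .N) := by
    intro i hi h1 h2
    have hf : ω.2.fc i = ((ω.2.fc i).1, w.2) := Prod.ext rfl h1
    have hW1 : ω.2.sIn i ≠ .W := fun e => hWwest _ h2 ⟨i, hi, hf, Or.inl e⟩
    have hW2 : ω.2.sOut i ≠ .W := fun e => hWwest _ h2 ⟨i, hi, hf, Or.inr e⟩
    have hE1 : ω.2.sIn i ≠ .E := fun e => hEwest _ h2 ⟨i, hi, hf, Or.inl e⟩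
    have hE2 : ω.2.sOut i ≠ .E := fun e => hEwest _ h2 ⟨i, hi, hf, Or.inr e⟩
    have hne := ω.2.sIn_ne_sOut hi
    revert hW1 hW2 hE1 hE2 hne; cases ω.2.sIn i <;> cases ω.2.sOut i <;> decide
  -- hence straight: every arc in a plaquette off the three rows (or on the root row west of the hole) is straight
  have hstM : ∀ x y : ℤ, Y' < y → y < r.2 → y ≠ w.2 → ∀ i < n, ω.2.fc i = (x, y) → arcKind (ω.2.sIn i) (ω.2.sOut i) = .straight := by
    intro x y h1 h2 h3 i hi hfi
    rcases hvertM i hi (by rw [hfi]; exact h1) (by rw [hfi]; exact h2) (by rw [hfi]; exact h3) with ⟨ha, hb⟩ | ⟨ha, hb⟩ <;> rw [ha, hb] <;> rfl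
  have hstW : ∀ x : ℤ, x ≤ w.1 - 2 → ∀ i < n, ω.2.fc i = (x, w.2) → arcKind (ω.2.sIn i) (ω.2.sOut i) = .straight := by
    intro x hx i hi hfi
    rcases hvertW i hi (by rw [hfi]) (by rw [hfi]; exact hx) with ⟨ha, hb⟩ | ⟨ha, hb⟩ <;> rw [ha, hb] <;> rfl
  ---------------------------------------------------------------- the end of the walk: `ξ₀` is left through `E` into a straight run to `L = (r.1 − 1, r.2)`, and is reached up the
  ---------------------------------------------------------------- column `x₀` from the bottom exit turn `b₁ = (x₀, Y')`
  have hξnW : ¬ω.2.UsesSide (x₀, r.2) .W := by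
    intro hW
    obtain ⟨M₁, hE₁, -, hend₁⟩ := ω.2.chain_W hX hW
    rcases hend₁ with ⟨hM1', hnot⟩ | ⟨hA0, -⟩ | ⟨-, hsZ⟩
    · obtain ⟨i₁, hi₁, hfc₁, hsv₁, -, -, -, hk₁'⟩ := ω.2.isolated_of_usesSide_not_opp (hE₁ M₁ hM1' le_rfl) hnot
      have hP₁ : P ((x₀ : ℤ) - M₁, r.2) := by rw [← hfc₁]; exact hPiso i₁ hi₁ hsv₁ hk₁'
      obtain ⟨a1, a2, a3, a4, a5⟩ := hout_top (((x₀ : ℤ) - M₁, r.2) : Face) rfl (by simp only; omega)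
      exact hkill7 _ hP₁ a1 a2 a3 a4 a5 (fun e => by have := congrArg Prod.fst e; simp only at this; omega)
    · rw [h0w] at hA0; have := congrArg Prod.snd hA0; simp only at this; omega
    · exact absurd hsZ hzW'
  have hξE : ω.2.UsesSide (x₀, r.2) .E := by
    rcases hξUses with hW | hEx
    · exact absurd hW hξnW
    · exact hEx
  obtain ⟨ML, hWL, hEL, hendL⟩ := ω.2.chain_E hX' hξE
  have hML : (x₀ : ℤ) + ML = r.1 - 1 := by
    rcases hendL with ⟨hM1', hnot⟩ | ⟨-, hs0⟩ | ⟨hZ, -⟩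
    · exfalso
      obtain ⟨i₁, hi₁, hfc₁, hsv₁, -, -, -, hk₁'⟩ := ω.2.isolated_of_usesSide_not_opp (hWL ML hM1' le_rfl) hnot
      have hP₁ : P ((x₀ : ℤ) + ML, r.2) := by rw [← hfc₁]; exact hPiso i₁ hi₁ hsv₁ hk₁'
      have hlt : (x₀ : ℤ) + ML < r.1 := by
        by_contra hge
        push Not at hge
        apply hrW
        have := hWL (r.1 - x₀).toNat (by omega) (by omega)
        have e : ((((x₀ : ℤ), r.2) : Face).1 + (((r.1 - x₀).toNat : ℕ) : ℤ), (((x₀ : ℤ), r.2) : Face).2) = r :=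
          Prod.ext (by simp only; omega) rfl
        rwa [e] at this
      obtain ⟨a1, a2, a3, a4, a5⟩ := hout_top (((x₀ : ℤ) + ML, r.2) : Face) rfl (by simp only; omega)
      exact hkill7 _ hP₁ a1 a2 a3 a4 a5 (fun e => by have := congrArg Prod.fst e; simp only at this; omega)
    · exact absurd hs0 h0E
    · rw [hfcZ] at hZ; have := congrArg Prod.fst hZ; simp only at this; omega
  -- `ξ₀` is entered from `S` and left through `E`
  have hξsides : ω.2.sIn iξ = .S ∧ ω.2.sOut iξ = .E := by
    have hUE : ω.2.sIn iξ = .E ∨ ω.2.sOut iξ = .E := by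
      obtain ⟨a, ha, hfa, hsa⟩ := hξE
      rw [hsvξ a ha (hfa.trans hfcξ.symm)] at hsa; exact hsa
    rcases hUE with hEin | hEout
    · exfalso
      have hcells : ∀ m : ℕ, 1 ≤ m → m ≤ ML - 1 → ∀ i < n,
          ω.2.fc i = ((ω.2.fc iξ).1 + m, (ω.2.fc iξ).2) → arcKind (ω.2.sIn i) (ω.2.sOut i) = .straight := by
        intro m hm1 hm2 i hi hfi
        rw [hfcξ] at hfi
        exact ω.2.straight_of_usesSide_EW (hEL m (by omega)) (hWL m hm1 (by omega)) (hupN _ rfl) i hi hfi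
      have hMLi : ML - 1 ≤ iξ := by
        by_contra hlt
        push Not at hlt
        obtain ⟨hfc0, -⟩ := ω.2.run_back_east_of_straight hiξ le_rfl hEin
          (fun m hm1 hm2 i hi hfi => hcells m hm1 (by omega) i hi hfi) iξ le_rfl
        rw [Nat.sub_self, h0w, hfcξ] at hfc0
        have := congrArg Prod.snd hfc0; simp only at this; omega
      obtain ⟨hfcb, hinb⟩ := ω.2.run_back_east_of_straight hiξ hMLi hEin hcells (ML - 1) le_rfl
      rw [hfcξ] at hfcb
      have h1b : 1 ≤ iξ - (ML - 1) := by
        by_contra hlt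
        have e0 : iξ - (ML - 1) = 0 := by omega
        rw [e0, h0W] at hinb; exact absurd hinb (by decide)
      obtain ⟨hfcL', houtL'⟩ := ω.2.fc_pred_eq_of_sIn_E (i := iξ - (ML - 1)) (by omega) h1b hinb
      rw [hfcb] at hfcL'
      have hfcL'' : ω.2.fc (iξ - (ML - 1) - 1) = (r.1 - 1, r.2) := by
        rw [hfcL']; exact Prod.ext (by simp only; omega) (by simp only)
      have := hsvTop (n - 1) (by omega) (by rw [hfcZ]) _ (by omega) (hfcL''.trans hfcZ.symm)
      rw [this, hzE] at houtL'
      exact absurd houtL' (by decide)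
    · rcases hSiξ with hS | hS
      · exact ⟨hS, hEout⟩
      · exact absurd (hS.symm.trans hEout) (by decide)
  -- reading the column `x₀` downwards from `ξ₀`: straight cells (the root-row cell is `P₀`) to the bottom row
  set Hd : ℕ := (r.2 - Y').toNat - 1 with hHd
  have hcellsξ : ∀ m : ℕ, 1 ≤ m → m ≤ Hd → ∀ i < n,
      ω.2.fc i = ((ω.2.fc iξ).1, (ω.2.fc iξ).2 - m) → arcKind (ω.2.sIn i) (ω.2.sOut i) = .straight := by
    intro m hm1 hm2 i hi hfi
    rw [hfcξ] at hfi
    by_cases hmw : (r.2 : ℤ) - m = w.2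
    · have : ω.2.fc i = ω.2.fc i' := by rw [hfi, hfcP]; exact Prod.ext rfl (by simp only; omega)
      rw [hPsv i hi this]; exact hPst
    · exact hstM x₀ (r.2 - m) (by omega) (by omega) hmw i hi (by rw [hfi])
  have hξdn : Hd ≤ iξ := by
    by_contra hlt
    push Not at hlt
    obtain ⟨hfc0, -⟩ := ω.2.run_back_below_of_straight hiξ le_rfl hξsides.1
      (fun m hm1 hm2 i hi hfi => hcellsξ m hm1 (by omega) i hi hfi) iξ le_rfl
    rw [Nat.sub_self, h0w, hfcξ] at hfc0
    have := congrArg Prod.fst hfc0; simp only at this; omega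
  obtain ⟨hfcd, hind⟩ := ω.2.run_back_below_of_straight hiξ hξdn hξsides.1 hcellsξ _ le_rfl
  rw [hfcξ] at hfcd
  have h1d : 1 ≤ iξ - Hd := by
    by_contra hlt
    have e0 : iξ - Hd = 0 := by omega
    rw [e0, h0W] at hind; exact absurd hind (by decide)
  obtain ⟨hfcb1, houtb1⟩ := fc_sOut_pred_of_sIn_S ω.2 (i := iξ - Hd) (by omega) h1d hind
  rw [hfcd] at hfcb1
  have hfcb1' : ω.2.fc (iξ - Hd - 1) = ((x₀ : ℤ), Y') := by rw [hfcb1]; exact Prod.ext (by simp only) (by simp only; omega)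
  -- that bottom plaquette is left through `N`: it is the exit turn `b₁`
  have hb₁ : ω.2.fc j₁ = ((x₀ : ℤ), Y') := by
    have hPb : P ((x₀ : ℤ), Y') := by
      rw [← hfcb1']
      refine hPiso _ (by omega) (hsvB _ (by omega) (by rw [hfcb1'])) ?_
      have h1 := (hbotS (iξ - Hd - 1) (by omega) (by rw [hfcb1'])).1
      rw [houtb1]; revert h1; cases ω.2.sIn (iξ - Hd - 1) <;> decide
    by_contra hne
    have hne0 : (((x₀ : ℤ), Y') : Face) ≠ ω.2.fc j₀ := by
      intro e
      have hj := hsvB j₀ hj₀ hrow₀' _ (by omega) (hfcb1'.trans e)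
      have hne' := ω.2.sIn_ne_sOut (show iξ - Hd - 1 < n by omega)
      rw [houtb1, hj, hN₀'] at hne'
      exact hne' rfl
    exact hkill7 _ hPb (hne_of_row _ _ (by simp only; omega)) (hne_of_row _ _ (by simp only; omega)) hne0 (Ne.symm hne)
      (hne_of_row _ _ (by simp only; omega)) (hne_of_row _ _ (by simp only; omega))
  ---------------------------------------------------------------- a doubly visited plaquette lies on the root row, at `p₁` or east of it
  have hkiss_row : ∀ i j : ℕ, i < n → j < n → ω.2.fc i = ω.2.fc j → i ≠ j → (ω.2.fc i).2 = w.2 ∧ w.1 + k ≤ (ω.2.fc i).1 := by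
    intro i j hi hj hfij hij
    have hall : ∀ s, ω.2.UsesSide ((ω.2.fc i).1, (ω.2.fc i).2) s := fun s => ω.2.usesSide_of_fc_eq hi hj hij hfij s
    have hr1 : Y' ≤ (ω.2.fc i).2 := hY' i hi
    have hr2 : (ω.2.fc i).2 ≤ r.2 := htop i hi
    -- not on the top row, not on the bottom row
    have hnt : (ω.2.fc i).2 ≠ r.2 := fun e => hij (hsvTop i hi e j hj hfij.symm).symm
    have hnb : (ω.2.fc i).2 ≠ Y' := fun e => hij (hsvB i hi e j hj hfij.symm).symm
    -- not on a middle row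
    have hroww : (ω.2.fc i).2 = w.2 := by
      by_contra hne
      exact hWkill _ _ (hall .W) (by omega) (by omega) hne
    refine ⟨hroww, ?_⟩
    by_contra hlt
    push Not at hlt
    rcases lt_trichotomy (ω.2.fc i).1 (w.1 - 1) with hwest | hhole | heast
    · -- west of the hole: both horizontal chains end at outsiders west of the hole
      obtain ⟨M₁, hE₁, -, hend₁⟩ := ω.2.chain_W hX (hall .W)
      obtain ⟨hP₁, hM₁1⟩ : P ((ω.2.fc i).1 - M₁, w.2) ∧ 1 ≤ M₁ := by
        rcases hend₁ with ⟨hM1', hnot⟩ | ⟨hA0, -⟩ | ⟨hZ, -⟩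
        · obtain ⟨i₁, hi₁, hfc₁, hsv₁, -, -, -, hk₁'⟩ := ω.2.isolated_of_usesSide_not_opp (hE₁ M₁ hM1' le_rfl) hnot
          refine ⟨?_, hM1'⟩
          have := hPiso i₁ hi₁ hsv₁ hk₁'
          rw [hfc₁, hroww] at this; exact this
        · rw [h0w] at hA0; have := congrArg Prod.fst hA0; simp only at this; omega
        · rw [hfcZ] at hZ; have := congrArg Prod.snd hZ; simp only at this; omega
      obtain ⟨M₂, hM₂, hP₂, hW₂, -, -⟩ := hEend _ _ (hall .E) (by omega)
      rw [hroww] at hP₂ hW₂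
      have hM₂h : (ω.2.fc i).1 + M₂ ≤ w.1 - 2 := by
        by_contra hge
        have hD := hPD _ _ (hW₂ (w.1 - 1 - (ω.2.fc i).1).toNat (by omega) (by omega))
        have e : (((ω.2.fc i).1 + ((w.1 - 1 - (ω.2.fc i).1).toNat : ℕ), w.2) : Face) = holeFaceW w := by
          simp only [holeFaceW]; exact Prod.ext (by simp only; omega) rfl
        rw [e] at hD; exact hh hD
      obtain ⟨a1, a2, a3, a4, a5⟩ := hout_row (((ω.2.fc i).1 - M₁, w.2) : Face) rfl (by simp only; omega)
      obtain ⟨c1, c2, c3, c4, c5⟩ := hout_row (((ω.2.fc i).1 + M₂, w.2) : Face) rfl (by simp only; omega)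
      exact houts _ _ hP₁ hP₂ (fun e => by have := congrArg Prod.fst e; simp only at this; omega) a1 a2 a3 a4 a5 c1 c2 c3 c4 c5
    · -- the hole itself
      have hD := hPD _ _ (hall .W)
      have e : (((ω.2.fc i).1, (ω.2.fc i).2) : Face) = holeFaceW w := by
        simp only [holeFaceW]; exact Prod.ext (by simp only; omega) (by simp only; omega)
      rw [e] at hD; exact hh hD
    · -- on the initial run: a straight, singly visited cell
      have hm₀ : ((ω.2.fc i).1 - w.1).toNat < k := by omega
      obtain ⟨hfm, -⟩ := hrun ((ω.2.fc i).1 - w.1).toNat hm₀.le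
      have hsm := hstr _ hm₀
      have hfi' : ω.2.fc i = ω.2.fc ((ω.2.fc i).1 - w.1).toNat := by
        rw [hfm]; exact Prod.ext (by simp only; omega) (by simp only; omega)
      rcases eq_or_ne i ((ω.2.fc i).1 - w.1).toNat with hei | hnei
      · have hnej : j ≠ ((ω.2.fc i).1 - w.1).toNat := fun e => hij (hei.trans e.symm)
        exact (ω.2.not_straight_of_two_arcs (show ((ω.2.fc i).1 - w.1).toNat < n by omega) hj hnej.symm (hfij.symm.trans hfi')).1
          (ω.2.sOut_of_straight (by omega) hsm)
      · exact (ω.2.not_straight_of_two_arcs (show ((ω.2.fc i).1 - w.1).toNat < n by omega) hi hnei.symm hfi').1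
          (ω.2.sOut_of_straight (by omega) hsm)
  -- the `S`-chain of a kiss ends at `b₀`: all kisses lie in the column of `b₀`
  have hkiss_col : ∀ i j : ℕ, i < n → j < n → ω.2.fc i = ω.2.fc j → i ≠ j → (ω.2.fc i).1 = (ω.2.fc j₀).1 := by
    intro i j hi hj hfij hij
    obtain ⟨hroww, hcolk⟩ := hkiss_row i j hi hj hfij hij
    have hall : ∀ s, ω.2.UsesSide ((ω.2.fc i).1, (ω.2.fc i).2) s := fun s => ω.2.usesSide_of_fc_eq hi hj hij hfij s
    obtain ⟨Mu, hMu1, hMurow, hPη, -, -, -, hηUses, -⟩ := hSend _ _ (hall .S)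
    rw [hroww] at hMurow hPη hηUses
    have hηbot := hSbot_of _ _ _ hPη le_rfl hMurow hηUses hMu1
    rw [hηbot] at hPη
    by_contra hne
    have hne0 : (((ω.2.fc i).1, Y') : Face) ≠ ω.2.fc j₀ := fun e => hne (by have := congrArg Prod.fst e; simpa using this)
    have hne1 : (((ω.2.fc i).1, Y') : Face) ≠ ω.2.fc j₁ := fun e => by
      rw [hb₁] at e; have := congrArg Prod.fst e; simp only at this; omega
    exact hkill7 _ hPη (hne_of_row _ _ (by simp only; omega)) (hne_of_row _ _ (by simp only; omega)) hne0 hne1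
      (hne_of_row _ _ (by simp only; omega)) (hne_of_row _ _ (by simp only; omega))
  -- the `N`-chain of a kiss ends at `r` or at `t'`
  have hkiss_top : ∀ i j : ℕ, i < n → j < n → ω.2.fc i = ω.2.fc j → i ≠ j → (ω.2.fc i).1 = r.1 ∨ (ω.2.fc i).1 = r.1 + M := by
    intro i j hi hj hfij hij
    obtain ⟨hroww, hcolk⟩ := hkiss_row i j hi hj hfij hij
    have hall : ∀ s, ω.2.UsesSide ((ω.2.fc i).1, (ω.2.fc i).2) s := fun s => ω.2.usesSide_of_fc_eq hi hj hij hfij s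
    obtain ⟨Mv, hMv1, hMvrow, hPζ, -, -, -, hζUses, -⟩ := hNend _ _ (hall .N)
    rw [hroww] at hMvrow hPζ hζUses
    have hζtop := hNtop_of _ _ _ hPζ le_rfl hMvrow hζUses hMv1
    rw [hζtop] at hPζ
    by_contra hne
    push Not at hne
    exact hkill7 _ hPζ (fun e => hne.2 (by have := congrArg Prod.fst e; simp only at this; omega))
      (fun e => hne.1 (by have := congrArg Prod.fst e; simp only at this; omega))
      (hne_of_row _ _ (by rw [hrow₀']; simp only; omega)) (hne_of_row _ _ (by rw [hrow₁']; simp only; omega))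
      (hne_of_row _ _ (by simp only; omega)) (fun e => by have := congrArg Prod.fst e; simp only at this; omega)
  -- hence every kiss is `p₁`: a kiss east of `p₁` has its `W`-chain running back to `w` through `p₁`, which would make `p₁` a kiss in another column
  have hkiss_p₁ : ∀ i j : ℕ, i < n → j < n → ω.2.fc i = ω.2.fc j → i ≠ j → ω.2.fc i = (w.1 + k, w.2) := by
    intro i j hi hj hfij hij
    obtain ⟨hroww, hcolk⟩ := hkiss_row i j hi hj hfij hij
    rcases lt_or_eq_of_le hcolk with hgt | heq
    swap
    · exact Prod.ext heq.symm hroww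
    exfalso
    have hall : ∀ s, ω.2.UsesSide ((ω.2.fc i).1, (ω.2.fc i).2) s := fun s => ω.2.usesSide_of_fc_eq hi hj hij hfij s
    obtain ⟨M₁, hE₁, hW₁, hend₁⟩ := ω.2.chain_W hX (hall .W)
    rw [hroww] at hE₁ hW₁ hend₁
    have hpE : ω.2.UsesSide (w.1 + k, w.2) .E := by
      rcases hend₁ with ⟨hM1', hnot⟩ | ⟨hA0, -⟩ | ⟨-, hsZ⟩
      · exfalso
        obtain ⟨i₁, hi₁, hfc₁, hsv₁, -, -, -, hk₁'⟩ := ω.2.isolated_of_usesSide_not_opp (hE₁ M₁ hM1' le_rfl) hnot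
        have hP₁ : P ((ω.2.fc i).1 - M₁, w.2) := by rw [← hfc₁]; exact hPiso i₁ hi₁ hsv₁ hk₁'
        have hnot' : ¬ω.2.UsesSide ((ω.2.fc i).1 - M₁, w.2) .W := hnot
        exact hkill7 _ hP₁ (hne_of_row _ _ (by simp only; omega)) (hne_of_row _ _ (by simp only; omega))
          (hne_of_row _ _ (by rw [hrow₀']; simp only; omega)) (hne_of_row _ _ (by rw [hrow₁']; simp only; omega))
          (fun e => hnot' (by rw [e]; exact hτW)) (hne_of_row _ _ (by simp only; omega))
      · rw [h0w] at hA0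
        have hM₁w : (M₁ : ℤ) = (ω.2.fc i).1 - w.1 := by have := congrArg Prod.fst hA0; simp only at this; omega
        have := hE₁ ((ω.2.fc i).1 - (w.1 + k)).toNat (by omega) (by omega)
        have e : ((((ω.2.fc i).1, w.2) : Face).1 - ((((ω.2.fc i).1 - (w.1 + k)).toNat : ℕ) : ℤ), (((ω.2.fc i).1, w.2) : Face).2) =
            ((w.1 : ℤ) + k, w.2) := Prod.ext (by simp only; omega) rfl
        rwa [e] at this
      · exact absurd hsZ hzW'
    obtain ⟨b, hb, hfb, hbE⟩ := hpE
    have hkb : k ≠ b := by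
      rintro rfl
      rw [hWk] at hbE
      rcases hbE with e | e
      · exact absurd e (by decide)
      · exact hkEo e
    have h1 := hkiss_col k b hk₁ hb (hfk.trans hfb.symm) hkb
    rw [hfk] at h1
    have h2 := hkiss_col i j hi hj hfij hij
    simp only at h1
    omega
  -- in particular, a root-row plaquette east of `p₁` is singly visited
  have hsv_east : ∀ a < n, (ω.2.fc a).2 = w.2 → w.1 + k < (ω.2.fc a).1 → ∀ l < n, ω.2.fc l = ω.2.fc a → l = a := by
    intro a ha hrow hgt l hl hfl
    by_contra hne
    have := hkiss_p₁ l a hl ha hfl hne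
    rw [hfl] at this
    have := congrArg Prod.fst this; simp only at this; omega
  ---------------------------------------------------------------- the column under `r`: its `S`-chain ends at an isolated turn `e = (r.1, r.2 − Mc)`
  obtain ⟨Mc, hNc, hSc, hendc⟩ := ω.2.chain_S hY' hrUS
  obtain ⟨hMc1, hnotS⟩ : 1 ≤ Mc ∧ ¬ω.2.UsesSide (r.1, r.2 - Mc) .S := by
    rcases hendc with hT | ⟨-, hs0⟩ | ⟨-, hsZ⟩
    · exact hT
    · exact absurd hs0 h0S
    · exact absurd hsZ hzS'
  obtain ⟨iE, hiE, hfcE, hsvE, hNE, hninE, hnoutE, hkE⟩ := ω.2.isolated_of_usesSide_not_opp (hNc Mc hMc1 le_rfl) hnotS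
  have hPe : P (r.1, r.2 - Mc) := by rw [← hfcE]; exact hPiso iE hiE hsvE hkE
  have heY' : Y' ≤ r.2 - Mc := by have := hY' iE hiE; rw [hfcE] at this; exact this
  have heUses : ω.2.UsesSide (r.1, r.2 - Mc) .W ∨ ω.2.UsesSide (r.1, r.2 - Mc) .E := by rw [← hfcE]; exact hHor iE hiE hkE
  have hMc : (r.2 : ℤ) - w.2 ≤ Mc := by
    by_contra hlt
    exact hmid_kill _ hPe (by simp only; omega) (by simp only; omega) (by simp only; omega) heUses
  ---------------------------------------------------------------- the conclusion, once `r.1 = w.1 + k` and the first turn leaves through `N`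
  have hfinish : r.1 = w.1 + k → ω.2.sOut k = .N →
      (∀ i j : ℕ, i < n → j < n → ω.2.fc i = ω.2.fc j → i ≠ j → ω.2.fc i = (w.1 + k, w.2) ∧
        ((ω.2.sIn i = .W ∧ ω.2.sOut i = .N ∧ ω.2.sIn j = .E ∧ ω.2.sOut j = .S) ∨
          (ω.2.sIn i = .E ∧ ω.2.sOut i = .S ∧ ω.2.sIn j = .W ∧ ω.2.sOut j = .N))) →
      ω.2.sIn ω.2.firstHitG = .S ∧ ω.2.sOut ω.2.firstHitG = .E ∧ ω.2.sIn k = .W ∧ ω.2.sOut k = .N ∧ k < ω.2.firstHitG ∧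
        (∀ i < ω.2.firstHitG, i ≠ k → arcKind (ω.2.sIn i) (ω.2.sOut i) = .straight) ∧
        (∀ i j : ℕ, i < n → j < n → ω.2.fc i = ω.2.fc j → i ≠ j → ω.2.fc i = (w.1 + k, w.2) ∧
          ((ω.2.sIn i = .W ∧ ω.2.sOut i = .N ∧ ω.2.sIn j = .E ∧ ω.2.sOut j = .S) ∨
            (ω.2.sIn i = .E ∧ ω.2.sOut i = .S ∧ ω.2.sIn j = .W ∧ ω.2.sOut j = .N))) := by
    intro hrk hkN hkiss
    set Hu : ℕ := (r.2 - w.2).toNat - 1 with hHu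
    have hup : ∀ m : ℕ, 1 ≤ m → m ≤ Hu → ∀ i < n,
        ω.2.fc i = ((ω.2.fc k).1, (ω.2.fc k).2 + m) → arcKind (ω.2.sIn i) (ω.2.sOut i) = .straight := by
      intro m hm1 hm2 i hi hfi
      rw [hfk] at hfi
      exact hstM (w.1 + k) (w.2 + m) (by omega) (by omega) (by omega) i hi (by rw [hfi])
    have hkMn : k + Hu < n := by
      by_contra hge
      push Not at hge
      obtain ⟨hfcL', -⟩ := ω.2.run_up_of_straight (j := k) (M := n - 1 - k) (by omega) hkN
        (fun m hm1 hmM i hi hfi => hup m hm1 (by omega) i hi hfi) (n - 1 - k) le_rfl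
      rw [show k + (n - 1 - k) = n - 1 by omega, hfcZ, hfk] at hfcL'
      have := congrArg Prod.fst hfcL'; simp only at this; omega
    have hrunk := ω.2.run_up_of_straight (j := k) (M := Hu) hkMn hkN hup
    obtain ⟨hfcL', houtL'⟩ := hrunk _ le_rfl
    rw [hfk] at hfcL'
    have hkMn' : k + Hu + 1 < n := by
      by_contra hge
      have e1 : k + Hu = n - 1 := by omega
      rw [e1, hfcZ] at hfcL'
      have := congrArg Prod.fst hfcL'; simp only at this; omega
    have hfcr' := ω.2.fc_succ_eq_of_sOut_N (i := k + Hu) hkMn' houtL'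
    have hinr := sIn_succ_of_sOut_N ω.2 (i := k + Hu) hkMn' houtL'
    rw [hfcL'] at hfcr'
    have hfcr'' : ω.2.fc (k + Hu + 1) = r := by rw [hfcr']; exact Prod.ext (by simp only; omega) (by simp only; omega)
    have hfhk : k + Hu + 1 = ω.2.firstHitG := hsvr _ hkMn' (hfcr''.trans hfcF.symm)
    rw [hfhk] at hinr
    have hEout : ω.2.sOut ω.2.firstHitG = .E := by
      rcases hkey with ⟨-, h2⟩ | ⟨h1, -⟩
      · exact h2
      · rw [hinr] at h1; exact absurd h1 (by decide)
    refine ⟨hinr, hEout, hWk, hkN, by omega, fun i hi hik => ?_, hkiss⟩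
    rcases Nat.lt_or_ge i k with hlt | hge
    · exact hstrk i hlt
    · obtain ⟨hfcm, -⟩ := hrunk (i - k) (by omega)
      rw [show k + (i - k) = i by omega, hfk] at hfcm
      exact hup (i - k) (by omega) (by omega) i (by omega) (by rw [hfcm, hfk])
  rcases lt_or_eq_of_le hMc with hlow | hroot'
  swap
  · ---------------------------------------------------------------- `e` on the root row: it is `τ`; hence `r.1 = w.1 + k`, `e = p₁` is singly visited, and the arc `k` is `W → N`
    have hroot : (r.2 : ℤ) - Mc = w.2 := by omega
    rw [hroot] at hfcE hPe heUses hnotS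
    have heτ : (τ1 : ℤ) = r.1 := by
      by_contra hne
      exact hkill7 _ hPe (hne_of_row _ _ (by simp only; omega)) (hne_of_row _ _ (by simp only; omega))
        (hne_of_row _ _ (by rw [hrow₀']; simp only; omega)) (hne_of_row _ _ (by rw [hrow₁']; simp only; omega))
        (fun e => hne (by have := congrArg Prod.fst e; simp only at this; omega)) (hne_of_row _ _ (by simp only; omega))
    have hrk : r.1 = w.1 + k := by
      rcases lt_or_eq_of_le (show w.1 + (k : ℤ) ≤ r.1 by omega) with hgt | heq
      · exfalso
        -- `τ ≠ p₁`: `p₁` uses `E`, so it is a kiss — but its column is neither `r.1` nor `t'.1`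
        have hpE : ω.2.UsesSide (w.1 + k, w.2) .E := by
          rcases hτalt with ⟨heq', -⟩ | ⟨-, h2, -, -⟩
          · exfalso; omega
          · exact h2
        obtain ⟨b, hb, hfb, hbE⟩ := hpE
        have hkb : k ≠ b := by
          rintro rfl
          rw [hWk] at hbE
          rcases hbE with e | e
          · exact absurd e (by decide)
          · exact hkEo e
        rcases hkiss_top k b hk₁ hb (hfk.trans hfb.symm) hkb with h1 | h1 <;> rw [hfk] at h1 <;> simp only at h1 <;> omega
      · exact heq.symm
    have hkE' : k = iE := hsvE _ hk₁ (by rw [hfk, hfcE, hrk])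
    have hkN : ω.2.sOut k = .N := by
      rcases hNE with h1 | h1
      · rw [← hkE', hWk] at h1; exact absurd h1 (by decide)
      · rw [← hkE'] at h1; exact h1
    refine hfinish hrk hkN fun i j hi hj hfij hij => ?_
    exfalso
    have hfi := hkiss_p₁ i j hi hj hfij hij
    have h1 := hsvE i hi (by rw [hfi, hfcE, hrk])
    have h2 := hsvE j hj (by rw [← hfij, hfi, hfcE, hrk])
    exact hij (h1.trans h2.symm)
  · ---------------------------------------------------------------- `e` on the bottom row: it is `b₀`, and the column of `r` is a wall down to the bottom row
    have heq : (r.2 : ℤ) - Mc = Y' := by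
      rcases lt_or_eq_of_le heY' with hlt | heq
      · exact (hmid_kill _ hPe (by simp only; exact hlt) (by simp only; omega) (by simp only; omega) heUses).elim
      · exact heq.symm
    have heb₀ : (((r.1 : ℤ), r.2 - Mc) : Face) = ω.2.fc j₀ := by
      by_contra hne
      refine hkill7 _ hPe (hne_of_row _ _ (by simp only; omega)) (hne_of_row _ _ (by simp only; omega)) hne ?_
        (hne_of_row _ _ (by simp only; omega)) (hne_of_row _ _ (by simp only; omega))
      rw [hb₁]; intro e; have := congrArg Prod.fst e; simp only at this; omega
    have hqN : ω.2.UsesSide (r.1, w.2) .N := by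
      have := hNc (r.2 - w.2).toNat (by omega) (by omega)
      rwa [show (r.2 : ℤ) - ((r.2 - w.2).toNat : ℕ) = w.2 by omega] at this
    have hqS : ω.2.UsesSide (r.1, w.2) .S := by
      have := hSc (r.2 - w.2).toNat (by omega)
      rwa [show (r.2 : ℤ) - ((r.2 - w.2).toNat : ℕ) = w.2 by omega] at this
    ---- `τ` helpers: a root-row cell east of `p₁` reached from the east along a straight run, etc. — first `r.1 = w.1 + k`
    have hrk : r.1 = w.1 + k := by
      rcases lt_trichotomy r.1 (w.1 + (k : ℤ)) with hlt | heq' | hgt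
      · -- `q` on the initial run: a straight cell using `N`
        exfalso
        have hm₀ : (r.1 - w.1).toNat < k := by omega
        obtain ⟨hfm, hWm⟩ := hrun (r.1 - w.1).toNat hm₀.le
        have hsm := hstrk _ hm₀
        have hout := ω.2.sOut_of_straight (show (r.1 - w.1).toNat < n by omega) hsm
        obtain ⟨a, ha, hfa, hsa⟩ := hqN
        have hfa' : ω.2.fc a = ω.2.fc (r.1 - w.1).toNat := by rw [hfa, hfm]; exact Prod.ext (by simp only; omega) rfl
        have ea : a = (r.1 - w.1).toNat := by
          by_contra hne
          exact (ω.2.not_straight_of_two_arcs (show (r.1 - w.1).toNat < n by omega) ha (Ne.symm hne) hfa').1 hout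
        rw [ea, hWm] at hsa
        rw [hWm] at hout
        rcases hsa with hs | hs
        · exact absurd hs (by decide)
        · rw [hout] at hs; exact absurd hs (by decide)
      · exact heq'
      · exfalso
        -- `q = (r.1, w.2)` is singly visited (a kiss would be `p₁`) and uses `N`, `S`: no `W`
        have hqsv : ∀ a < n, ω.2.fc a = (r.1, w.2) → ∀ l < n, ω.2.fc l = ω.2.fc a → l = a :=
          fun a ha hfa => hsv_east a ha (by rw [hfa]) (by rw [hfa]; exact hgt)
        have hqW : ¬ω.2.UsesSide (r.1, w.2) .W := by
          rintro ⟨c, hc', hfc', hsc⟩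
          obtain ⟨a, ha, hfa, hsa⟩ := hqN
          obtain ⟨b, hb, hfb, hsb⟩ := hqS
          have eba := hqsv a ha hfa b hb (hfb.trans hfa.symm)
          have eca := hqsv a ha hfa c hc' (hfc'.trans hfa.symm)
          rw [eba] at hsb
          rw [eca] at hsc
          have hne := ω.2.sIn_ne_sOut ha
          revert hsa hsb hsc hne; cases ω.2.sIn a <;> cases ω.2.sOut a <;> decide
        -- the column read upwards from `b₀`: `r` is left through `S`, so entered from `E`
        have hallSt : ∀ m : ℕ, 1 ≤ m → m ≤ Mc - 1 → ∀ i < n,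
            ω.2.fc i = ((ω.2.fc j₀).1, (ω.2.fc j₀).2 + m) → arcKind (ω.2.sIn i) (ω.2.sOut i) = .straight := by
          intro m hm1 hm2 i hi hfi
          rw [← heb₀] at hfi
          by_cases hmw : (r.2 : ℤ) - Mc + m = w.2
          · have hfi' : ω.2.fc i = (r.1, w.2) := by rw [hfi]; exact Prod.ext rfl (by simp only; omega)
            exact ω.2.straight_of_usesSide_NS hqN hqS hqW i hi hfi'
          · exact hstM r.1 (r.2 - Mc + m) (by omega) (by omega) hmw i hi (by rw [hfi])
        have hMcj : Mc - 1 ≤ j₀ := by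
          by_contra hlt
          push Not at hlt
          obtain ⟨-, hin0⟩ := ω.2.run_back_above_of_straight hj₀ le_rfl hN₀'
            (fun m hm1 hm2 i hi hfi => hallSt m hm1 (by omega) i hi hfi) j₀ le_rfl
          rw [Nat.sub_self, h0W] at hin0; exact absurd hin0 (by decide)
        obtain ⟨hfcu, hinu⟩ := ω.2.run_back_above_of_straight hj₀ hMcj hN₀' hallSt (Mc - 1) le_rfl
        rw [← heb₀] at hfcu
        have h1u : 1 ≤ j₀ - (Mc - 1) := by
          by_contra hlt
          have e0 : j₀ - (Mc - 1) = 0 := by omega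
          rw [e0, h0W] at hinu; exact absurd hinu (by decide)
        obtain ⟨hfcr', houtr'⟩ := fc_sOut_pred_of_sIn_N ω.2 (i := j₀ - (Mc - 1)) (by omega) h1u hinu
        rw [hfcu] at hfcr'
        have hfcr'' : ω.2.fc (j₀ - (Mc - 1) - 1) = r := by rw [hfcr']; exact Prod.ext (by simp only) (by simp only; omega)
        have hjr : j₀ - (Mc - 1) - 1 = ω.2.firstHitG := hsvr _ (by omega) (hfcr''.trans hfcF.symm)
        rw [hjr] at houtr'
        have hEin : ω.2.sIn ω.2.firstHitG = .E := by
          rcases hkey with ⟨-, h2⟩ | ⟨h1, -⟩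
          · rw [houtr'] at h2; exact absurd h2 (by decide)
          · exact h1
        -- `t'` was visited before the first hit, entered from below
        have hcellsT : ∀ m : ℕ, 1 ≤ m → m ≤ M - 1 → ∀ i < n,
            ω.2.fc i = ((ω.2.fc ω.2.firstHitG).1 + m, (ω.2.fc ω.2.firstHitG).2) → arcKind (ω.2.sIn i) (ω.2.sOut i) = .straight := by
          intro m hm1 hm2 i hi hfi
          rw [hfcF] at hfi
          exact ω.2.straight_of_usesSide_EW (hEall m (by omega)) (hWall m hm1 (by omega)) (hupN _ rfl) i hi hfi
        have hMfh : M - 1 ≤ ω.2.firstHitG := by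
          by_contra hlt
          push Not at hlt
          obtain ⟨hfc0, -⟩ := ω.2.run_back_east_of_straight hF le_rfl hEin
            (fun m hm1 hm2 i hi hfi => hcellsT m hm1 (by omega) i hi hfi) ω.2.firstHitG le_rfl
          rw [Nat.sub_self, h0w, hfcF] at hfc0
          have := congrArg Prod.snd hfc0; simp only at this; omega
        obtain ⟨hfct, hint⟩ := ω.2.run_back_east_of_straight hF hMfh hEin hcellsT (M - 1) le_rfl
        rw [hfcF] at hfct
        have h1t : 1 ≤ ω.2.firstHitG - (M - 1) := by
          by_contra hlt
          have e0 : ω.2.firstHitG - (M - 1) = 0 := by omega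
          rw [e0, h0w] at hfct
          have := congrArg Prod.snd hfct; simp only at this; omega
        obtain ⟨hfcT', houtT'⟩ := ω.2.fc_pred_eq_of_sIn_E (i := ω.2.firstHitG - (M - 1)) (by omega) h1t hint
        rw [hfct] at hfcT'
        have hfcT'' : ω.2.fc (ω.2.firstHitG - (M - 1) - 1) = (r.1 + M, r.2) := by
          rw [hfcT']; exact Prod.ext (by simp only; omega) (by simp only)
        have hiTF : ω.2.firstHitG - (M - 1) - 1 = iT := hsvT _ (by omega) (hfcT''.trans hfcT.symm)
        rw [hiTF] at houtT'
        have hinT : ω.2.sIn iT = .S := by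
          have hne := ω.2.sIn_ne_sOut hiT
          have h1 := (hNtop iT hiT (by rw [hfcT])).1
          rw [houtT'] at hne
          revert hninT hne h1; cases ω.2.sIn iT <;> decide
        -- down the column of `t'` to the root row
        have hcellsTc : ∀ m : ℕ, 1 ≤ m → m ≤ (r.2 - w.2).toNat - 1 → ∀ i < n,
            ω.2.fc i = ((ω.2.fc iT).1, (ω.2.fc iT).2 - m) → arcKind (ω.2.sIn i) (ω.2.sOut i) = .straight := by
          intro m hm1 hm2 i hi hfi
          rw [hfcT] at hfi
          exact hstM (r.1 + M) (r.2 - m) (by omega) (by omega) (by omega) i hi (by rw [hfi])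
        have hMciT : (r.2 - w.2).toNat - 1 ≤ iT := by
          by_contra hlt
          push Not at hlt
          obtain ⟨hfc0, -⟩ := ω.2.run_back_below_of_straight hiT le_rfl hinT
            (fun m hm1 hm2 i hi hfi => hcellsTc m hm1 (by omega) i hi hfi) iT le_rfl
          rw [Nat.sub_self, h0w, hfcT] at hfc0
          have := congrArg Prod.fst hfc0; simp only at this; omega
        obtain ⟨hfcc, hinc⟩ := ω.2.run_back_below_of_straight hiT hMciT hinT hcellsTc _ le_rfl
        rw [hfcT] at hfcc
        have h1c : 1 ≤ iT - ((r.2 - w.2).toNat - 1) := by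
          by_contra hlt
          have e0 : iT - ((r.2 - w.2).toNat - 1) = 0 := by omega
          rw [e0, h0w] at hfcc
          have := congrArg Prod.fst hfcc; simp only at this; omega
        obtain ⟨hfcc', houtc'⟩ := fc_sOut_pred_of_sIn_S ω.2 (i := iT - ((r.2 - w.2).toNat - 1)) (by omega) h1c hinc
        rw [hfcc] at hfcc'
        have hicn : iT - ((r.2 - w.2).toNat - 1) - 1 < n := by omega
        have hfcc'' : ω.2.fc (iT - ((r.2 - w.2).toNat - 1) - 1) = (r.1 + M, w.2) := by
          rw [hfcc']; exact Prod.ext (by simp only) (by simp only; omega)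
        have hnec := ω.2.sIn_ne_sOut hicn
        rw [houtc'] at hnec
        have hc'sv : ∀ l < n, ω.2.fc l = ω.2.fc (iT - ((r.2 - w.2).toNat - 1) - 1) → l = iT - ((r.2 - w.2).toNat - 1) - 1 :=
          hsv_east _ hicn (by rw [hfcc'']) (by rw [hfcc'']; simp only; omega)
        rcases hsc : ω.2.sIn (iT - ((r.2 - w.2).toNat - 1) - 1) with _ | _ | _ | _
        · -- from `W`: `τ`; but `q` lies strictly between `p₁` and `τ` and does not use `W`
          have hPc : P (r.1 + M, w.2) := by
            rw [← hfcc'']; exact hPiso _ hicn hc'sv (by rw [hsc, houtc']; decide)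
          have hτc : (τ1 : ℤ) = r.1 + M := by
            by_contra hne
            exact hkill7 _ hPc (hne_of_row _ _ (by simp only; omega)) (hne_of_row _ _ (by simp only; omega))
              (hne_of_row _ _ (by rw [hrow₀']; simp only; omega)) (hne_of_row _ _ (by rw [hrow₁']; simp only; omega))
              (fun e => hne (by have := congrArg Prod.fst e; simp only at this; omega)) (hne_of_row _ _ (by simp only; omega))
          have hτWs : ∀ m : ℕ, 1 ≤ m → (m : ℤ) ≤ τ1 - (w.1 + k) → ω.2.UsesSide (w.1 + k + m, w.2) .W := by
            rcases hτalt with ⟨heq', -⟩ | ⟨-, -, h3, -⟩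
            · exfalso; omega
            · exact h3
          apply hqW
          have := hτWs (r.1 - (w.1 + k)).toNat (by omega) (by omega)
          rwa [show (w.1 : ℤ) + k + ((r.1 - (w.1 + k)).toNat : ℕ) = r.1 by omega] at this
        · -- from `E`: an isolated `E → N` turn on the root row would be `τ`, which does not use `E`
          have hPc : P (r.1 + M, w.2) := by
            rw [← hfcc'']; exact hPiso _ hicn hc'sv (by rw [hsc, houtc']; decide)
          refine hkill7 _ hPc (hne_of_row _ _ (by simp only; omega)) (hne_of_row _ _ (by simp only; omega))
            (hne_of_row _ _ (by rw [hrow₀']; simp only; omega)) (hne_of_row _ _ (by rw [hrow₁']; simp only; omega))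
            (fun e => hτnE ?_) (hne_of_row _ _ (by simp only; omega))
          rw [← e]; exact ⟨_, hicn, hfcc'', Or.inl hsc⟩
        · -- from `S`: straight on down to the bottom row, left through `N` there — a third bottom turn
          set ic := iT - ((r.2 - w.2).toNat - 1) - 1 with hic
          have hcellsL : ∀ m : ℕ, 1 ≤ m → m ≤ (w.2 - Y').toNat - 1 → ∀ i < n,
              ω.2.fc i = ((ω.2.fc ic).1, (ω.2.fc ic).2 - m) → arcKind (ω.2.sIn i) (ω.2.sOut i) = .straight := by
            intro m hm1 hm2 i hi hfi
            rw [hfcc''] at hfi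
            exact hstM (r.1 + M) (w.2 - m) (by omega) (by omega) (by omega) i hi (by rw [hfi])
          have hLic : (w.2 - Y').toNat - 1 ≤ ic := by
            by_contra hlt
            push Not at hlt
            obtain ⟨hfc0, -⟩ := ω.2.run_back_below_of_straight hicn le_rfl hsc
              (fun m hm1 hm2 i hi hfi => hcellsL m hm1 (by omega) i hi hfi) ic le_rfl
            rw [Nat.sub_self, h0w, hfcc''] at hfc0
            have := congrArg Prod.fst hfc0; simp only at this; omega
          obtain ⟨hfcl, hinl⟩ := ω.2.run_back_below_of_straight hicn hLic hsc hcellsL _ le_rfl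
          rw [hfcc''] at hfcl
          have h1l : 1 ≤ ic - ((w.2 - Y').toNat - 1) := by
            by_contra hlt
            have e0 : ic - ((w.2 - Y').toNat - 1) = 0 := by omega
            rw [e0, h0w] at hfcl
            have := congrArg Prod.fst hfcl; simp only at this; omega
          obtain ⟨hfcb', houtb'⟩ := fc_sOut_pred_of_sIn_S ω.2 (i := ic - ((w.2 - Y').toNat - 1)) (by omega) h1l hinl
          rw [hfcl] at hfcb'
          have hfcb'' : ω.2.fc (ic - ((w.2 - Y').toNat - 1) - 1) = (r.1 + M, Y') := by
            rw [hfcb']; exact Prod.ext (by simp only) (by simp only; omega)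
          have hPb : P (r.1 + M, Y') := by
            rw [← hfcb'']
            refine hPiso _ (by omega) (hsvB _ (by omega) (by rw [hfcb''])) ?_
            have h1 := (hbotS (ic - ((w.2 - Y').toNat - 1) - 1) (by omega) (by rw [hfcb''])).1
            rw [houtb']; revert h1; cases ω.2.sIn (ic - ((w.2 - Y').toNat - 1) - 1) <;> decide
          refine hkill7 _ hPb (hne_of_row _ _ (by simp only; omega)) (hne_of_row _ _ (by simp only; omega)) ?_ ?_
            (hne_of_row _ _ (by simp only; omega)) (hne_of_row _ _ (by simp only; omega))
          · rw [← heb₀]; intro e; have := congrArg Prod.fst e; simp only at this; omega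
          · rw [hb₁]; intro e; have := congrArg Prod.fst e; simp only at this; omega
        · exact absurd hsc hnec
    ---- so `q = p₁`: reading the lower column upwards from `b₀`, `p₁` has an arc leaving through `S`
    have hlowSt : ∀ m : ℕ, 1 ≤ m → m ≤ (w.2 - Y').toNat - 1 → ∀ i < n,
        ω.2.fc i = ((ω.2.fc j₀).1, (ω.2.fc j₀).2 + m) → arcKind (ω.2.sIn i) (ω.2.sOut i) = .straight := by
      intro m hm1 hm2 i hi hfi
      rw [← heb₀] at hfi
      exact hstM r.1 (r.2 - Mc + m) (by omega) (by omega) (by omega) i hi (by rw [hfi])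
    have hLj : (w.2 - Y').toNat - 1 ≤ j₀ := by
      by_contra hlt
      push Not at hlt
      obtain ⟨-, hin0⟩ := ω.2.run_back_above_of_straight hj₀ le_rfl hN₀'
        (fun m hm1 hm2 i hi hfi => hlowSt m hm1 (by omega) i hi hfi) j₀ le_rfl
      rw [Nat.sub_self, h0W] at hin0; exact absurd hin0 (by decide)
    obtain ⟨hfcs, hins⟩ := ω.2.run_back_above_of_straight hj₀ hLj hN₀' hlowSt _ le_rfl
    rw [← heb₀] at hfcs
    have h1s : 1 ≤ j₀ - ((w.2 - Y').toNat - 1) := by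
      by_contra hlt
      have e0 : j₀ - ((w.2 - Y').toNat - 1) = 0 := by omega
      rw [e0, h0W] at hins; exact absurd hins (by decide)
    obtain ⟨hfcS', houtS'⟩ := fc_sOut_pred_of_sIn_N ω.2 (i := j₀ - ((w.2 - Y').toNat - 1)) (by omega) h1s hins
    rw [hfcs] at hfcS'
    set iS := j₀ - ((w.2 - Y').toNat - 1) - 1 with hiS
    have hiSn : iS < n := by omega
    have hfcS : ω.2.fc iS = (w.1 + k, w.2) := by rw [hfcS', hrk]; exact Prod.ext (by simp only) (by simp only; omega)
    ---- the first turn leaves through `N`: otherwise it is the arc `iS`, the other arc of `p₁` joins `N` and `E`, and the walk would have to close the cycle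
    ---- `p₁ → r → t' → τ → p₁`
    have hkN : ω.2.sOut k = .N := by
      rcases hkNS with hN | hS
      · exact hN
      exfalso
      have hkiS : k = iS := by
        obtain ⟨-, hout1⟩ := ω.2.side_sIn_eq_nth hk₁
        obtain ⟨-, hout2⟩ := ω.2.side_sIn_eq_nth hiSn
        rw [hfk, hS] at hout1
        rw [hfcS, houtS'] at hout2
        have := ω.2.nth_inj (show k + 1 ≤ n by omega) (show iS + 1 ≤ n by omega) (hout1.symm.trans hout2)
        omega
      -- the other arc `b` of `p₁` uses `N`, and joins `N` and `E`
      obtain ⟨b, hb, hfb, hbN⟩ := hqN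
      rw [hrk] at hfb
      have hbk : b ≠ k := by rintro rfl; rw [hWk, hS] at hbN; rcases hbN with e | e <;> exact absurd e (by decide)
      obtain ⟨-, d1, d2, d3, d4⟩ := ω.2.not_straight_of_two_arcs hk₁ hb (Ne.symm hbk) (hfb.trans hfk.symm)
      rw [hWk] at d1 d3
      rw [hS] at d2 d4
      have hbsides : (ω.2.sIn b = .N ∧ ω.2.sOut b = .E) ∨ (ω.2.sIn b = .E ∧ ω.2.sOut b = .N) := by
        have hne := ω.2.sIn_ne_sOut hb
        revert hbN d1 d2 d3 d4 hne; cases ω.2.sIn b <;> cases ω.2.sOut b <;> decide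
      -- `τ`: `p₁` uses `E` through `b`, so `τ` lies east of `p₁` and the cells in between use `W` and `E` — and are straight
      obtain ⟨hτgt, -, hτWs, hτEs⟩ : w.1 + (k : ℤ) < τ1 ∧ ω.2.UsesSide (w.1 + k, w.2) .E ∧
          (∀ m : ℕ, 1 ≤ m → (m : ℤ) ≤ τ1 - (w.1 + k) → ω.2.UsesSide (w.1 + k + m, w.2) .W) ∧
          ∀ m : ℕ, (m : ℤ) < τ1 - (w.1 + k) → ω.2.UsesSide (w.1 + k + m, w.2) .E := by
        rcases hτalt with ⟨-, hnE⟩ | h4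
        · exfalso; apply hnE
          rcases hbsides with ⟨-, h2⟩ | ⟨h1, -⟩
          · exact ⟨b, hb, hfb, Or.inr h2⟩
          · exact ⟨b, hb, hfb, Or.inl h1⟩
        · exact h4
      have hrowSt : ∀ m : ℕ, 1 ≤ m → (m : ℤ) < τ1 - (w.1 + k) → ∀ i < n, ω.2.fc i = (w.1 + k + m, w.2) →
          arcKind (ω.2.sIn i) (ω.2.sOut i) = .straight := by
        intro m hm1 hm2
        refine ω.2.straight_of_usesSide_EW (s := .N) (hτEs m hm2) (hτWs m hm1 (by omega)) ?_
        rintro ⟨a, ha, hfa, hsa⟩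
        obtain ⟨c, hc', hfc', hsc⟩ := hτWs m hm1 (by omega)
        obtain ⟨d, hd, hfd, hsd⟩ := hτEs m hm2
        have hsv := hsv_east a ha (by rw [hfa]) (by rw [hfa]; simp only; omega)
        rw [hsv c hc' (hfc'.trans hfa.symm)] at hsc
        rw [hsv d hd (hfd.trans hfa.symm)] at hsd
        have hne := ω.2.sIn_ne_sOut ha
        revert hsa hsc hsd hne; cases ω.2.sIn a <;> cases ω.2.sOut a <;> decide
      -- the bottom of `τ`'s column is no bottom turn; its top, if a turn, is `t'`
      have hτbot : ∀ a < n, ω.2.fc a = ((τ1 : ℤ), Y') → arcKind (ω.2.sIn a) (ω.2.sOut a) ≠ .straight → False := by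
        intro a ha hfa hka
        have hPa : P ((τ1 : ℤ), Y') := by rw [← hfa]; exact hPiso a ha (hsvB a ha (by rw [hfa])) hka
        refine hkill7 _ hPa (hne_of_row _ _ (by simp only; omega)) (hne_of_row _ _ (by simp only; omega)) ?_ ?_
          (hne_of_row _ _ (by simp only; omega)) (hne_of_row _ _ (by simp only; omega))
        · rw [← heb₀]; intro e; have := congrArg Prod.fst e; simp only at this; omega
        · rw [hb₁]; intro e; have := congrArg Prod.fst e; simp only at this; omega
      have hτtop : ∀ a < n, ω.2.fc a = ((τ1 : ℤ), r.2) → arcKind (ω.2.sIn a) (ω.2.sOut a) ≠ .straight → a = iT := by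
        intro a ha hfa hka
        have hPa : P ((τ1 : ℤ), r.2) := by rw [← hfa]; exact hPiso a ha (hsvTop a ha (by rw [hfa])) hka
        have hτt : (τ1 : ℤ) = r.1 + M := by
          by_contra hne
          exact hkill7 _ hPa (fun e => hne (by have := congrArg Prod.fst e; simp only at this; omega))
            (fun e => by have := congrArg Prod.fst e; simp only at this; omega)
            (hne_of_row _ _ (by rw [hrow₀']; simp only; omega)) (hne_of_row _ _ (by rw [hrow₁']; simp only; omega))
            (hne_of_row _ _ (by simp only; omega)) (fun e => by have := congrArg Prod.fst e; simp only at this; omega)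
        exact hsvT a ha (by rw [hfa, hfcT, hτt])
      -- the middle / lower cells of `τ`'s column are straight
      have hτcolU : ∀ m : ℕ, 1 ≤ m → m ≤ (r.2 - w.2).toNat - 1 → ∀ i < n, ω.2.fc i = ((τ1 : ℤ), w.2 + m) →
          arcKind (ω.2.sIn i) (ω.2.sOut i) = .straight :=
        fun m hm1 hm2 i hi hfi => hstM τ1 (w.2 + m) (by omega) (by omega) (by omega) i hi hfi
      have hτcolD : ∀ m : ℕ, 1 ≤ m → m ≤ (w.2 - Y').toNat - 1 → ∀ i < n, ω.2.fc i = ((τ1 : ℤ), w.2 - m) →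
          arcKind (ω.2.sIn i) (ω.2.sOut i) = .straight :=
        fun m hm1 hm2 i hi hfi => hstM τ1 (w.2 - m) (by omega) (by omega) (by omega) i hi hfi
      -- the cells between `r` and `t'`, counted from `t'`
      have hcellsT' : ∀ m : ℕ, 1 ≤ m → m ≤ M - 1 → ∀ i < n,
          ω.2.fc i = ((ω.2.fc iT).1 - m, (ω.2.fc iT).2) → arcKind (ω.2.sIn i) (ω.2.sOut i) = .straight := by
        intro m hm1 hm2 i hi hfi
        rw [hfcT] at hfi
        refine ω.2.straight_of_usesSide_EW (hEall (M - m) (by omega)) (hWall (M - m) (by omega) (by omega)) (hupN _ rfl) i hi ?_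
        rw [hfi]; exact Prod.ext (by simp only; omega) rfl
      rcases hkey with ⟨hSin, -⟩ | ⟨hEin, hSout⟩
      · ---- `r` entered from below: the arc of `p₁` through `N` is read backwards `E → N`, before the first hit; its `E`-entry comes from `τ`, left westwards,
        ---- entered from `N` (the bottom of its column is no turn), from `t'`, entered from `W` — from `r`'s `E` side, before the first hit: absurd
        have hcellsU : ∀ m : ℕ, 1 ≤ m → m ≤ (r.2 - w.2).toNat - 1 → ∀ i < n,
            ω.2.fc i = ((ω.2.fc ω.2.firstHitG).1, (ω.2.fc ω.2.firstHitG).2 - m) → arcKind (ω.2.sIn i) (ω.2.sOut i) = .straight := by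
          intro m hm1 hm2 i hi hfi
          rw [hfcF] at hfi
          exact hstM r.1 (r.2 - m) (by omega) (by omega) (by omega) i hi (by rw [hfi])
        have hUF : (r.2 - w.2).toNat - 1 ≤ ω.2.firstHitG := by
          by_contra hlt
          push Not at hlt
          obtain ⟨-, hin0⟩ := ω.2.run_back_below_of_straight hF le_rfl hSin
            (fun m hm1 hm2 i hi hfi => hcellsU m hm1 (by omega) i hi hfi) ω.2.firstHitG le_rfl
          rw [Nat.sub_self, h0W] at hin0; exact absurd hin0 (by decide)
        obtain ⟨hfcu, hinu⟩ := ω.2.run_back_below_of_straight hF hUF hSin hcellsU _ le_rfl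
        rw [hfcF] at hfcu
        have h1u : 1 ≤ ω.2.firstHitG - ((r.2 - w.2).toNat - 1) := by
          by_contra hlt
          have e0 : ω.2.firstHitG - ((r.2 - w.2).toNat - 1) = 0 := by omega
          rw [e0, h0W] at hinu; exact absurd hinu (by decide)
        obtain ⟨hfcb', houtb'⟩ := fc_sOut_pred_of_sIn_S ω.2 (i := ω.2.firstHitG - ((r.2 - w.2).toNat - 1)) (by omega) h1u hinu
        rw [hfcu] at hfcb'
        have hfcb'' : ω.2.fc (ω.2.firstHitG - ((r.2 - w.2).toNat - 1) - 1) = (w.1 + k, w.2) := by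
          rw [hfcb', hrk]; exact Prod.ext (by simp only) (by simp only; omega)
        have hib : ω.2.firstHitG - ((r.2 - w.2).toNat - 1) - 1 = b := by
          rcases ω.2.eq_or_eq_of_fc_eq_three hk₁ hb (show ω.2.firstHitG - ((r.2 - w.2).toNat - 1) - 1 < n by omega) (Ne.symm hbk)
              (hfb.trans hfk.symm) (hfcb''.trans hfk.symm) with h1 | h1
          · exfalso; rw [h1, hS] at houtb'; exact absurd houtb' (by decide)
          · exact h1
        rw [hib] at houtb'
        have hbEi : ω.2.sIn b = .E := by
          rcases hbsides with ⟨-, h2⟩ | ⟨h1, -⟩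
          · rw [houtb'] at h2; exact absurd h2 (by decide)
          · exact h1
        have hbF : b < ω.2.firstHitG := by omega
        -- back east from `b` to `τ`
        have hcellsE : ∀ m : ℕ, 1 ≤ m → m ≤ (τ1 - (w.1 + k)).toNat - 1 → ∀ i < n,
            ω.2.fc i = ((ω.2.fc b).1 + m, (ω.2.fc b).2) → arcKind (ω.2.sIn i) (ω.2.sOut i) = .straight := by
          intro m hm1 hm2 i hi hfi
          rw [hfb] at hfi
          exact hrowSt m hm1 (by omega) i hi hfi
        have hEb : (τ1 - (w.1 + k)).toNat - 1 ≤ b := by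
          by_contra hlt
          push Not at hlt
          obtain ⟨-, hin0⟩ := ω.2.run_back_east_of_straight hb le_rfl hbEi
            (fun m hm1 hm2 i hi hfi => hcellsE m hm1 (by omega) i hi hfi) b le_rfl
          rw [Nat.sub_self, h0W] at hin0; exact absurd hin0 (by decide)
        obtain ⟨hfce, hine⟩ := ω.2.run_back_east_of_straight hb hEb hbEi hcellsE _ le_rfl
        rw [hfb] at hfce
        have h1e : 1 ≤ b - ((τ1 - (w.1 + k)).toNat - 1) := by
          by_contra hlt
          have e0 : b - ((τ1 - (w.1 + k)).toNat - 1) = 0 := by omega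
          rw [e0, h0W] at hine; exact absurd hine (by decide)
        obtain ⟨hfcτ', houtτ⟩ := ω.2.fc_pred_eq_of_sIn_E (i := b - ((τ1 - (w.1 + k)).toNat - 1)) (by omega) h1e hine
        rw [hfce] at hfcτ'
        set iτ := b - ((τ1 - (w.1 + k)).toNat - 1) - 1 with hiτ
        have hiτn : iτ < n := by omega
        have hfcτ : ω.2.fc iτ = ((τ1 : ℤ), w.2) := by rw [hfcτ']; exact Prod.ext (by simp only; omega) (by simp only)
        have hτin : ω.2.sIn iτ = .N ∨ ω.2.sIn iτ = .S := by
          have hne := ω.2.sIn_ne_sOut hiτn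
          rw [houtτ] at hne
          have hnE : ω.2.sIn iτ ≠ .E := fun e => hτnE ⟨iτ, hiτn, hfcτ, Or.inl e⟩
          revert hne hnE; cases ω.2.sIn iτ <;> decide
        rcases hτin with hτN | hτS
        · -- from `N`: up the column, read backwards, to a top-row arc leaving through `S`: it is `t'`
          have hcellsV : ∀ m : ℕ, 1 ≤ m → m ≤ (r.2 - w.2).toNat - 1 → ∀ i < n,
              ω.2.fc i = ((ω.2.fc iτ).1, (ω.2.fc iτ).2 + m) → arcKind (ω.2.sIn i) (ω.2.sOut i) = .straight := by
            intro m hm1 hm2 i hi hfi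
            rw [hfcτ] at hfi
            exact hτcolU m hm1 hm2 i hi (by rw [hfi])
          have hVτ : (r.2 - w.2).toNat - 1 ≤ iτ := by
            by_contra hlt
            push Not at hlt
            obtain ⟨-, hin0⟩ := ω.2.run_back_above_of_straight hiτn le_rfl hτN
              (fun m hm1 hm2 i hi hfi => hcellsV m hm1 (by omega) i hi hfi) iτ le_rfl
            rw [Nat.sub_self, h0W] at hin0; exact absurd hin0 (by decide)
          obtain ⟨hfcv, hinv⟩ := ω.2.run_back_above_of_straight hiτn hVτ hτN hcellsV _ le_rfl
          rw [hfcτ] at hfcv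
          have h1v : 1 ≤ iτ - ((r.2 - w.2).toNat - 1) := by
            by_contra hlt
            have e0 : iτ - ((r.2 - w.2).toNat - 1) = 0 := by omega
            rw [e0, h0W] at hinv; exact absurd hinv (by decide)
          obtain ⟨hfct2, houtt2⟩ := fc_sOut_pred_of_sIn_N ω.2 (i := iτ - ((r.2 - w.2).toNat - 1)) (by omega) h1v hinv
          rw [hfcv] at hfct2
          have hfct2' : ω.2.fc (iτ - ((r.2 - w.2).toNat - 1) - 1) = ((τ1 : ℤ), r.2) := by
            rw [hfct2]; exact Prod.ext (by simp only) (by simp only; omega)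
          have hturn2 : arcKind (ω.2.sIn (iτ - ((r.2 - w.2).toNat - 1) - 1)) (ω.2.sOut (iτ - ((r.2 - w.2).toNat - 1) - 1)) ≠ .straight := by
            have h1 := (hNtop (iτ - ((r.2 - w.2).toNat - 1) - 1) (by omega) (by rw [hfct2'])).1
            rw [houtt2]; revert h1; cases ω.2.sIn (iτ - ((r.2 - w.2).toNat - 1) - 1) <;> decide
          have hiT2 := hτtop _ (by omega) hfct2' hturn2
          rw [hiT2] at houtt2
          have hWt : ω.2.sIn iT = .W := by
            rcases hWT with h1 | h1
            · exact h1
            · rw [houtt2] at h1; exact absurd h1 (by decide)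
          have hTM : M - 1 ≤ iT := by
            by_contra hlt
            push Not at hlt
            obtain ⟨-, hin0⟩ := ω.2.run_back_west_of_straight hiT le_rfl hWt
              (fun m hm1 hm2 i hi hfi => hcellsT' m hm1 (by omega) i hi hfi) iT le_rfl
            rw [Nat.sub_self] at hin0
            -- `sIn 0 = W` is fine; use the position instead
            obtain ⟨hfc0, -⟩ := ω.2.run_back_west_of_straight hiT le_rfl hWt
              (fun m hm1 hm2 i hi hfi => hcellsT' m hm1 (by omega) i hi hfi) iT le_rfl
            rw [Nat.sub_self, h0w, hfcT] at hfc0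
            have := congrArg Prod.snd hfc0; simp only at this; omega
          obtain ⟨hfcw, hinw⟩ := ω.2.run_back_west_of_straight hiT hTM hWt hcellsT' _ le_rfl
          rw [hfcT] at hfcw
          have h1w : 1 ≤ iT - (M - 1) := by
            by_contra hlt
            have e0 : iT - (M - 1) = 0 := by omega
            rw [e0, h0w] at hfcw
            have := congrArg Prod.snd hfcw; simp only at this; omega
          obtain ⟨hfcr3, houtr3⟩ := ω.2.fc_pred_eq_of_sIn_W (i := iT - (M - 1)) (by omega) h1w hinw
          rw [hfcw] at hfcr3
          have hfcr3' : ω.2.fc (iT - (M - 1) - 1) = r := by rw [hfcr3]; exact Prod.ext (by simp only; omega) (by simp only)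
          have := hsvr _ (by omega) (hfcr3'.trans hfcF.symm)
          omega
        · -- from `S`: down the column, read backwards, to a bottom arc leaving through `N`: a turn, absurd
          have hcellsV : ∀ m : ℕ, 1 ≤ m → m ≤ (w.2 - Y').toNat - 1 → ∀ i < n,
              ω.2.fc i = ((ω.2.fc iτ).1, (ω.2.fc iτ).2 - m) → arcKind (ω.2.sIn i) (ω.2.sOut i) = .straight := by
            intro m hm1 hm2 i hi hfi
            rw [hfcτ] at hfi
            exact hτcolD m hm1 hm2 i hi (by rw [hfi])
          have hVτ : (w.2 - Y').toNat - 1 ≤ iτ := by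
            by_contra hlt
            push Not at hlt
            obtain ⟨-, hin0⟩ := ω.2.run_back_below_of_straight hiτn le_rfl hτS
              (fun m hm1 hm2 i hi hfi => hcellsV m hm1 (by omega) i hi hfi) iτ le_rfl
            rw [Nat.sub_self, h0W] at hin0; exact absurd hin0 (by decide)
          obtain ⟨hfcv, hinv⟩ := ω.2.run_back_below_of_straight hiτn hVτ hτS hcellsV _ le_rfl
          rw [hfcτ] at hfcv
          have h1v : 1 ≤ iτ - ((w.2 - Y').toNat - 1) := by
            by_contra hlt
            have e0 : iτ - ((w.2 - Y').toNat - 1) = 0 := by omega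
            rw [e0, h0W] at hinv; exact absurd hinv (by decide)
          obtain ⟨hfcd2, houtd2⟩ := fc_sOut_pred_of_sIn_S ω.2 (i := iτ - ((w.2 - Y').toNat - 1)) (by omega) h1v hinv
          rw [hfcv] at hfcd2
          have hfcd2' : ω.2.fc (iτ - ((w.2 - Y').toNat - 1) - 1) = ((τ1 : ℤ), Y') := by
            rw [hfcd2]; exact Prod.ext (by simp only) (by simp only; omega)
          refine hτbot _ (by omega) hfcd2' ?_
          have h1 := (hbotS (iτ - ((w.2 - Y').toNat - 1) - 1) (by omega) (by rw [hfcd2'])).1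
          rw [houtd2]; revert h1; cases ω.2.sIn (iτ - ((w.2 - Y').toNat - 1) - 1) <;> decide
      · ---- `r` entered from `E`, left downwards: the column is read DOWN into `p₁` (the arc `N → E` of `p₁`, after the first hit); but `r` was entered from
        ---- `t'`, reached from below out of `τ`'s column, and `τ` was entered from `W` along the row — out of `p₁`'s `E` side, before the first hit: absurd
        have hcellsU : ∀ m : ℕ, 1 ≤ m → m ≤ (r.2 - w.2).toNat - 1 → ∀ i < n,
            ω.2.fc i = ((ω.2.fc ω.2.firstHitG).1, (ω.2.fc ω.2.firstHitG).2 - m) → arcKind (ω.2.sIn i) (ω.2.sOut i) = .straight := by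
          intro m hm1 hm2 i hi hfi
          rw [hfcF] at hfi
          exact hstM r.1 (r.2 - m) (by omega) (by omega) (by omega) i hi (by rw [hfi])
        have hUF : ω.2.firstHitG + ((r.2 - w.2).toNat - 1) + 1 < n := by
          by_contra hge
          push Not at hge
          obtain ⟨hfcL', -⟩ := ω.2.run_down_of_straight (j := ω.2.firstHitG) (M := n - 1 - ω.2.firstHitG) (by omega) hSout
            (fun m hm1 hmM i hi hfi => hcellsU m hm1 (by omega) i hi hfi) (n - 1 - ω.2.firstHitG) le_rfl
          rw [show ω.2.firstHitG + (n - 1 - ω.2.firstHitG) = n - 1 by omega, hfcZ, hfcF] at hfcL'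
          have := congrArg Prod.fst hfcL'; simp only at this; omega
        obtain ⟨hfcu, houtu⟩ := ω.2.run_down_of_straight (j := ω.2.firstHitG) (M := (r.2 - w.2).toNat - 1) (by omega) hSout hcellsU _ le_rfl
        rw [hfcF] at hfcu
        have hfcb' := ω.2.fc_succ_eq_of_sOut_S (i := ω.2.firstHitG + ((r.2 - w.2).toNat - 1)) hUF houtu
        have hinb' := sIn_succ_of_sOut_S ω.2 (i := ω.2.firstHitG + ((r.2 - w.2).toNat - 1)) hUF houtu
        rw [hfcu] at hfcb'
        have hfcb'' : ω.2.fc (ω.2.firstHitG + ((r.2 - w.2).toNat - 1) + 1) = (w.1 + k, w.2) := by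
          rw [hfcb', hrk]; exact Prod.ext (by simp only) (by simp only; omega)
        have hib : ω.2.firstHitG + ((r.2 - w.2).toNat - 1) + 1 = b := by
          rcases ω.2.eq_or_eq_of_fc_eq_three hk₁ hb hUF (Ne.symm hbk) (hfb.trans hfk.symm) (hfcb''.trans hfk.symm) with h1 | h1
          · exfalso; rw [h1, hWk] at hinb'; exact absurd hinb' (by decide)
          · exact h1
        rw [hib] at hinb'
        have hbEo : ω.2.sOut b = .E := by
          rcases hbsides with ⟨-, h2⟩ | ⟨h1, -⟩
          · exact h2
          · rw [hinb'] at h1; exact absurd h1 (by decide)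
        have hbF : ω.2.firstHitG < b := by omega
        -- `r` entered from `E`: back east along the top row to `t'`, entered from below
        have hcellsT : ∀ m : ℕ, 1 ≤ m → m ≤ M - 1 → ∀ i < n,
            ω.2.fc i = ((ω.2.fc ω.2.firstHitG).1 + m, (ω.2.fc ω.2.firstHitG).2) → arcKind (ω.2.sIn i) (ω.2.sOut i) = .straight := by
          intro m hm1 hm2 i hi hfi
          rw [hfcF] at hfi
          exact ω.2.straight_of_usesSide_EW (hEall m (by omega)) (hWall m hm1 (by omega)) (hupN _ rfl) i hi hfi
        have hMfh : M - 1 ≤ ω.2.firstHitG := by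
          by_contra hlt
          push Not at hlt
          obtain ⟨hfc0, -⟩ := ω.2.run_back_east_of_straight hF le_rfl hEin
            (fun m hm1 hm2 i hi hfi => hcellsT m hm1 (by omega) i hi hfi) ω.2.firstHitG le_rfl
          rw [Nat.sub_self, h0w, hfcF] at hfc0
          have := congrArg Prod.snd hfc0; simp only at this; omega
        obtain ⟨hfct, hint⟩ := ω.2.run_back_east_of_straight hF hMfh hEin hcellsT (M - 1) le_rfl
        rw [hfcF] at hfct
        have h1t : 1 ≤ ω.2.firstHitG - (M - 1) := by
          by_contra hlt
          have e0 : ω.2.firstHitG - (M - 1) = 0 := by omega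
          rw [e0, h0w] at hfct
          have := congrArg Prod.snd hfct; simp only at this; omega
        obtain ⟨hfcT', houtT'⟩ := ω.2.fc_pred_eq_of_sIn_E (i := ω.2.firstHitG - (M - 1)) (by omega) h1t hint
        rw [hfct] at hfcT'
        have hfcT'' : ω.2.fc (ω.2.firstHitG - (M - 1) - 1) = (r.1 + M, r.2) := by
          rw [hfcT']; exact Prod.ext (by simp only; omega) (by simp only)
        have hiTF : ω.2.firstHitG - (M - 1) - 1 = iT := hsvT _ (by omega) (hfcT''.trans hfcT.symm)
        rw [hiTF] at houtT'
        have hinT : ω.2.sIn iT = .S := by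
          have hne := ω.2.sIn_ne_sOut hiT
          have h1 := (hNtop iT hiT (by rw [hfcT])).1
          rw [houtT'] at hne
          revert hninT hne h1; cases ω.2.sIn iT <;> decide
        have hiTlt : iT < ω.2.firstHitG := by omega
        -- down `t'`'s column (read backwards) to the root row: the cell `(r.1 + M, w.2)`, left through `N`
        have hcellsTc : ∀ m : ℕ, 1 ≤ m → m ≤ (r.2 - w.2).toNat - 1 → ∀ i < n,
            ω.2.fc i = ((ω.2.fc iT).1, (ω.2.fc iT).2 - m) → arcKind (ω.2.sIn i) (ω.2.sOut i) = .straight := by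
          intro m hm1 hm2 i hi hfi
          rw [hfcT] at hfi
          exact hstM (r.1 + M) (r.2 - m) (by omega) (by omega) (by omega) i hi (by rw [hfi])
        have hMciT : (r.2 - w.2).toNat - 1 ≤ iT := by
          by_contra hlt
          push Not at hlt
          obtain ⟨hfc0, -⟩ := ω.2.run_back_below_of_straight hiT le_rfl hinT
            (fun m hm1 hm2 i hi hfi => hcellsTc m hm1 (by omega) i hi hfi) iT le_rfl
          rw [Nat.sub_self, h0w, hfcT] at hfc0
          have := congrArg Prod.fst hfc0; simp only at this; omega
        obtain ⟨hfcc, hinc⟩ := ω.2.run_back_below_of_straight hiT hMciT hinT hcellsTc _ le_rfl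
        rw [hfcT] at hfcc
        have h1c : 1 ≤ iT - ((r.2 - w.2).toNat - 1) := by
          by_contra hlt
          have e0 : iT - ((r.2 - w.2).toNat - 1) = 0 := by omega
          rw [e0, h0w] at hfcc
          have := congrArg Prod.fst hfcc; simp only at this; omega
        obtain ⟨hfcc', houtc'⟩ := fc_sOut_pred_of_sIn_S ω.2 (i := iT - ((r.2 - w.2).toNat - 1)) (by omega) h1c hinc
        rw [hfcc] at hfcc'
        set ic := iT - ((r.2 - w.2).toNat - 1) - 1 with hic
        have hicn : ic < n := by omega
        have hfcc'' : ω.2.fc ic = (r.1 + M, w.2) := by rw [hfcc']; exact Prod.ext (by simp only) (by simp only; omega)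
        have hnec := ω.2.sIn_ne_sOut hicn
        rw [houtc'] at hnec
        have hc'sv : ∀ l < n, ω.2.fc l = ω.2.fc ic → l = ic := hsv_east ic hicn (by rw [hfcc'']) (by rw [hfcc'']; simp only; omega)
        rcases hsc : ω.2.sIn ic with _ | _ | _ | _
        · -- from `W`: an isolated turn, `τ`; back west along the straight row to `p₁`, left through `E` — by the arc `b`, after the first hit: absurd
          have hPc : P (r.1 + M, w.2) := by rw [← hfcc'']; exact hPiso ic hicn hc'sv (by rw [hsc, houtc']; decide)
          have hτc : (τ1 : ℤ) = r.1 + M := by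
            by_contra hne
            exact hkill7 _ hPc (hne_of_row _ _ (by simp only; omega)) (hne_of_row _ _ (by simp only; omega))
              (hne_of_row _ _ (by rw [hrow₀']; simp only; omega)) (hne_of_row _ _ (by rw [hrow₁']; simp only; omega))
              (fun e => hne (by have := congrArg Prod.fst e; simp only at this; omega)) (hne_of_row _ _ (by simp only; omega))
          have hcellsW : ∀ m : ℕ, 1 ≤ m → m ≤ (τ1 - (w.1 + k)).toNat - 1 → ∀ i < n,
              ω.2.fc i = ((ω.2.fc ic).1 - m, (ω.2.fc ic).2) → arcKind (ω.2.sIn i) (ω.2.sOut i) = .straight := by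
            intro m hm1 hm2 i hi hfi
            rw [hfcc''] at hfi
            exact hrowSt ((τ1 - (w.1 + k)).toNat - m) (by omega) (by omega) i hi (by rw [hfi]; exact Prod.ext (by simp only; omega) rfl)
          have hWic : (τ1 - (w.1 + k)).toNat - 1 ≤ ic := by
            by_contra hlt
            push Not at hlt
            obtain ⟨hfc0, -⟩ := ω.2.run_back_west_of_straight hicn le_rfl hsc
              (fun m hm1 hm2 i hi hfi => hcellsW m hm1 (by omega) i hi hfi) ic le_rfl
            rw [Nat.sub_self, h0w, hfcc''] at hfc0
            have := congrArg Prod.fst hfc0; simp only at this; omega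
          obtain ⟨hfcw, hinw⟩ := ω.2.run_back_west_of_straight hicn hWic hsc hcellsW _ le_rfl
          rw [hfcc''] at hfcw
          have h1w : 1 ≤ ic - ((τ1 - (w.1 + k)).toNat - 1) := by
            by_contra hlt
            have e0 : ic - ((τ1 - (w.1 + k)).toNat - 1) = 0 := by omega
            rw [e0, h0w] at hfcw
            have := congrArg Prod.fst hfcw; simp only at this; omega
          obtain ⟨hfcp, houtp⟩ := ω.2.fc_pred_eq_of_sIn_W (i := ic - ((τ1 - (w.1 + k)).toNat - 1)) (by omega) h1w hinw
          rw [hfcw] at hfcp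
          have hfcp' : ω.2.fc (ic - ((τ1 - (w.1 + k)).toNat - 1) - 1) = (w.1 + k, w.2) := by
            rw [hfcp]; exact Prod.ext (by simp only; omega) (by simp only)
          rcases ω.2.eq_or_eq_of_fc_eq_three hk₁ hb (show ic - ((τ1 - (w.1 + k)).toNat - 1) - 1 < n by omega) (Ne.symm hbk)
              (hfb.trans hfk.symm) (hfcp'.trans hfk.symm) with h1 | h1
          · rw [h1, hS] at houtp; exact absurd houtp (by decide)
          · omega
        · -- from `E`: an isolated turn `E → N`: `τ`, which does not use `E`
          have hPc : P (r.1 + M, w.2) := by rw [← hfcc'']; exact hPiso ic hicn hc'sv (by rw [hsc, houtc']; decide)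
          refine hkill7 _ hPc (hne_of_row _ _ (by simp only; omega)) (hne_of_row _ _ (by simp only; omega))
            (hne_of_row _ _ (by rw [hrow₀']; simp only; omega)) (hne_of_row _ _ (by rw [hrow₁']; simp only; omega))
            (fun e => hτnE ?_) (hne_of_row _ _ (by simp only; omega))
          rw [← e]; exact ⟨ic, hicn, hfcc'', Or.inl hsc⟩
        · -- from `S`: straight on down to the bottom row: a third bottom turn
          have hcellsL : ∀ m : ℕ, 1 ≤ m → m ≤ (w.2 - Y').toNat - 1 → ∀ i < n,
              ω.2.fc i = ((ω.2.fc ic).1, (ω.2.fc ic).2 - m) → arcKind (ω.2.sIn i) (ω.2.sOut i) = .straight := by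
            intro m hm1 hm2 i hi hfi
            rw [hfcc''] at hfi
            exact hstM (r.1 + M) (w.2 - m) (by omega) (by omega) (by omega) i hi (by rw [hfi])
          have hLic : (w.2 - Y').toNat - 1 ≤ ic := by
            by_contra hlt
            push Not at hlt
            obtain ⟨hfc0, -⟩ := ω.2.run_back_below_of_straight hicn le_rfl hsc
              (fun m hm1 hm2 i hi hfi => hcellsL m hm1 (by omega) i hi hfi) ic le_rfl
            rw [Nat.sub_self, h0w, hfcc''] at hfc0
            have := congrArg Prod.fst hfc0; simp only at this; omega
          obtain ⟨hfcl, hinl⟩ := ω.2.run_back_below_of_straight hicn hLic hsc hcellsL _ le_rfl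
          rw [hfcc''] at hfcl
          have h1l : 1 ≤ ic - ((w.2 - Y').toNat - 1) := by
            by_contra hlt
            have e0 : ic - ((w.2 - Y').toNat - 1) = 0 := by omega
            rw [e0, h0w] at hfcl
            have := congrArg Prod.fst hfcl; simp only at this; omega
          obtain ⟨hfcb3, houtb3⟩ := fc_sOut_pred_of_sIn_S ω.2 (i := ic - ((w.2 - Y').toNat - 1)) (by omega) h1l hinl
          rw [hfcl] at hfcb3
          have hfcb3' : ω.2.fc (ic - ((w.2 - Y').toNat - 1) - 1) = (r.1 + M, Y') := by
            rw [hfcb3]; exact Prod.ext (by simp only) (by simp only; omega)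
          have hPb : P (r.1 + M, Y') := by
            rw [← hfcb3']
            refine hPiso _ (by omega) (hsvB _ (by omega) (by rw [hfcb3'])) ?_
            have h1 := (hbotS (ic - ((w.2 - Y').toNat - 1) - 1) (by omega) (by rw [hfcb3'])).1
            rw [houtb3]; revert h1; cases ω.2.sIn (ic - ((w.2 - Y').toNat - 1) - 1) <;> decide
          refine hkill7 _ hPb (hne_of_row _ _ (by simp only; omega)) (hne_of_row _ _ (by simp only; omega)) ?_ ?_
            (hne_of_row _ _ (by simp only; omega)) (hne_of_row _ _ (by simp only; omega))
          · rw [← heb₀]; intro e; have := congrArg Prod.fst e; simp only at this; omega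
          · rw [hb₁]; intro e; have := congrArg Prod.fst e; simp only at this; omega
        · exact absurd hsc hnec
    ---- the conclusion in the wall case: the arcs of `p₁` are `k : W → N` and `iS : E → S`
    have hkiS : k ≠ iS := by
      intro e; rw [e] at hkN; rw [hkN] at houtS'; exact absurd houtS' (by decide)
    obtain ⟨-, d1, d2, d3, d4⟩ := ω.2.not_straight_of_two_arcs hk₁ hiSn hkiS (hfcS.trans hfk.symm)
    rw [hWk] at d1 d3
    rw [hkN] at d2 d4
    have hSiS : ω.2.sIn iS = .E := by
      have hne := ω.2.sIn_ne_sOut hiSn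
      rw [houtS'] at hne d4
      revert d1 d2 hne; cases ω.2.sIn iS <;> decide
    refine hfinish hrk hkN fun i j hi hj hfij hij => ?_
    have hfi := hkiss_p₁ i j hi hj hfij hij
    have hfj : ω.2.fc j = (w.1 + k, w.2) := hfij.symm.trans hfi
    refine ⟨hfi, ?_⟩
    rcases ω.2.eq_or_eq_of_fc_eq_three hk₁ hiSn hi hkiS (hfcS.trans hfk.symm) (hfi.trans hfk.symm) with hi' | hi' <;>
      rcases ω.2.eq_or_eq_of_fc_eq_three hk₁ hiSn hj hkiS (hfcS.trans hfk.symm) (hfj.trans hfk.symm) with hj' | hj'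
    · exact absurd (hi'.trans hj'.symm) hij
    · left; rw [hi', hj']; exact ⟨hWk, hkN, hSiS, houtS'⟩
    · right; rw [hi', hj']; exact ⟨hSiS, houtS', hWk, hkN⟩
    · exact absurd (hi'.trans hj'.symm) hij

end ΩG

end Literature.Probability.RandomPlanarGeometry.SAW.YangBaxter
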